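import Literature.Analysis.FluidPDE.CaloricRemainderLocalEnergy
import Literature.Analysis.FluidPDE.PlateauWindowKernels
import Literature.Analysis.FluidPDE.KatoCaloricField
import HarnessLib

/-!
# The energy inequality of the caloric remainder tested in time: `φ = η(t) χ_R(x)`

Analysis/FluidPDE proof file (theorems only) on the Calderón / Rusin–Šverák route to the far-field
regularity of Kato's mild `L³` solution near the blow-up time
(`Literature.Analysis.FluidPDE.IsKatoSolutionOn.farField_bound`; W. Rusin, V. Šverák, J. Funct.
Anal. 260 (2011) = arXiv:0911.0500, §4 p. 6; C. P. Calderón, Trans. AMS 318 (1990), §1;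
P. G. Lemarié-Rieusset, *The Navier–Stokes problem in the 21st century* (2016), Prop. 15.1 and
proof of Thm. 14.7, pp. 516–518: the local energy inequality of the difference is tested with
`φ(s, x) = γ(s) φ₀(x)` and the error terms carrying `∇φ₀`, `Δφ₀` are estimated in the uniformly
local / global norms; here the remainder `w = u - e^{νtΔ}u₀` has finite energy and the cut-off
radius is sent to infinity later).

Let `(u, p)` be a distributional solution on the slab `(0, S) × ℝ³` with weak gradient `G` and the
CKN local energy inequality, `u ∈ L³`, `p ∈ L^{3/2}` on the strip, `u ∈ C([0, S); L³)`, and let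
`u₀ ∈ L³` be weakly divergence free and bounded, `|u₀| ≤ M`; put `e(t) = e^{νtΔ}u₀` and
`w = u - e`. For a smooth time weight `0 ≤ η ≤ 1` supported in `[t₁, t₂] ⊂ (0, S)` and the spatial
cut-off `χ_R` (`cutoff R`), the inequality `caloric_remainder_energy_inequality` tested with
`φ = η χ_R` (the field `e` being replaced by its smooth time cut-off, which agrees with `e` on the
support of `η`) becomes (`caloric_remainder_tested_inequality`):

  `ν ∫ η(t) g_R(t) dt ≤ ∫ η'(t) y_R(t) dt + ∫ η(t) (α(t) y_R(t) + β₀) dt + Err / R`,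

where `y_R(t) = ∫ |w(t)|² χ_R`, `g_R(t) = ∫ |G(t) - De(t)|² χ_R`,
`α(t) = 2 · 2^{3/2} M (νt)^{-1/2}` (twice the bound `‖De(t)‖_∞ ≤ 2^{3/2}(νt)^{-1/2} M`),
`β₀ = M ‖u₀‖₃³ / ν` (from `∫ χ_R |e|⁴ ≤ M ∫ |e(t)|³ ≤ M ‖u₀‖₃³`), and `Err` depends only on `ν`, `S`,
the strip norms of `u`, `e`, `p` and the cut-off profile (the terms carrying `∇χ_R = O(R⁻¹)` are
bounded through Young's inequality by `∫∫ (|u|³ + |w|³ + |e|³ + |p|^{3/2})`, the term carrying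
`Δχ_R = O(R⁻²)` through Young's inequality with the parameter `R^{-1/3}` on the box
`[t₁, t₂] × B(0, 2R)`, whose volume is `O(R³)`).

## Mathlib / tree search

Tree: `caloric_remainder_energy_inequality` (`CaloricRemainderLocalEnergy.lean`);
`isSpaceTimeTestOn_mul_of_support_subset`, `timeDeriv_mul_const_space`, `gradient_mul_const_time`,
`laplacian_mul_const_time` (`PlateauWindowKernels.lean`); `contDiff_uncurry_cutoffHeatFlow`,
`cutoffHeatFlow_eq_of_le`, `hasDerivAt_cutoffHeatFlow_time`, `isDivFree_cutoffHeatFlow`,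
`norm_fderiv_heatFlow_le_of_bound` (`KatoCaloricField.lean`); `norm_heatFlow_le`
(`MildSolutionProofs.lean`);
`cutoff`, `cutoff_nonneg`, `cutoff_le_one`, `cutoff_eq_zero`, `exists_norm_fderiv_cutoff_le`,
`exists_abs_laplacian_cutoff_le`, `hasCompactSupport_cutoff` (`WholeSpaceIBP.lean`,
`MildSolutionProofs.lean`); `aestronglyMeasurable_uncurry_heatFlow` (`HeatFlowLpClass.lean`),
`eLpNorm_heatFlow_le_holds`, `memLp_heatFlow_holds`; `volume_restrict_prod_univ_eq_prod`,
`lintegral_enorm_rpow_three_eq`, `memLp_of_lintegral_rpow_lt_top`.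

## References

* W. Rusin, V. Šverák, J. Funct. Anal. 260 (2011) 879–891 = arXiv:0911.0500, §4 p. 6.
  [RusinSverak2011]
* C. P. Calderón, Trans. Amer. Math. Soc. 318 (1990) 179–200, §1. [Calderon1990]
* P. G. Lemarié-Rieusset, *The Navier–Stokes problem in the 21st century*, CRC Press 2016,
  Prop. 15.1; Thm. 14.7, proof pp. 516–518. [LemarieRieusset2016]
-/

noncomputable section

open MeasureTheory TopologicalSpace Set Function Filter Topology Metric Real InnerProductSpace
open scoped ENNReal NNReal RealInnerProductSpace Laplacian

namespace Literature.Analysis.FluidPDE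

/-! ### Tools -/

section Tools

/-- Young's inequality `a² b ≤ (2a³ + b³)/3` for `a, b ≥ 0`. [folklore] -/
theorem sq_mul_le_two_cube_add_cube {a b : ℝ} (ha : 0 ≤ a) (hb : 0 ≤ b) :
    a ^ 2 * b ≤ (2 * a ^ 3 + b ^ 3) / 3 := by
  nlinarith [sq_nonneg (a - b), mul_nonneg (mul_nonneg ha ha) hb, mul_nonneg ha hb,
    mul_nonneg (sq_nonneg (a - b)) (add_nonneg (mul_nonneg two_pos.le ha) hb)]

/-- Young's inequality `a b ≤ (2 a^{3/2} + b³)/3` for `a, b ≥ 0`. [folklore] -/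
theorem mul_le_two_rpow_threeHalves_add_cube {a b : ℝ} (ha : 0 ≤ a) (hb : 0 ≤ b) :
    a * b ≤ (2 * a ^ (3 / 2 : ℝ) + b ^ 3) / 3 := by
  have hs : Real.sqrt a ^ 2 = a := Real.sq_sqrt ha
  have h32 : a ^ (3 / 2 : ℝ) = Real.sqrt a ^ 3 := by
    rw [Real.sqrt_eq_rpow, ← Real.rpow_natCast, ← Real.rpow_mul ha]
    norm_num
  have h := sq_mul_le_two_cube_add_cube (Real.sqrt_nonneg a) hb
  rw [hs] at h
  rw [h32]
  exact h

/-- **Domination on the strip.** If `F` vanishes off the strip `(0, S) × E`, is a.e.-strongly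
measurable there and is dominated there by `c Ψ` with `Ψ` integrable on the strip, then `F` is
integrable and `|∫∫ F| ≤ c ∫_{strip} Ψ` (iterated integral). [folklore] -/
theorem integrable_and_abs_integral_le_of_strip_bound {E : Type*} [MeasureSpace E] [SFinite (volume : Measure E)]
    {S c : ℝ} {F Ψ : ℝ × E → ℝ}
    (hFm : AEStronglyMeasurable F (volume.restrict (Ioo 0 S ×ˢ (univ : Set E))))
    (hF0 : ∀ z, z ∉ Ioo 0 S ×ˢ (univ : Set E) → F z = 0)
    (hΨ : IntegrableOn Ψ (Ioo 0 S ×ˢ (univ : Set E)) volume)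
    (hle : ∀ z ∈ Ioo 0 S ×ˢ (univ : Set E), |F z| ≤ c * Ψ z) :
    Integrable F volume ∧ |∫ t, ∫ x, F (t, x)| ≤ c * ∫ z in Ioo 0 S ×ˢ (univ : Set E), Ψ z := by
  have hmeas : MeasurableSet (Ioo 0 S ×ˢ (univ : Set E)) := measurableSet_Ioo.prod MeasurableSet.univ
  have hsupp : support F ⊆ Ioo 0 S ×ˢ (univ : Set E) := fun z hz => by
    by_contra h; exact hz (hF0 z h)
  have hFi : Integrable F volume := by
    refine (integrableOn_iff_integrable_of_support_subset hsupp).1 ?_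
    refine Integrable.mono' (hΨ.const_mul c) hFm ((ae_restrict_iff' hmeas).2 (Eventually.of_forall ?_))
    intro z hz
    rw [Real.norm_eq_abs]
    exact hle z hz
  refine ⟨hFi, ?_⟩
  rw [← integral_prod _ (by rw [← Measure.volume_eq_prod]; exact hFi), ← Measure.volume_eq_prod,
    ← setIntegral_eq_integral_of_forall_compl_eq_zero (s := Ioo 0 S ×ˢ (univ : Set E)) hF0,
    ← integral_const_mul]
  refine (abs_integral_le_integral_abs).trans (integral_mono_ae hFi.integrableOn.abs (hΨ.const_mul c) ?_)
  exact (ae_restrict_iff' hmeas).2 (Eventually.of_forall fun z hz => hle z hz)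

end Tools

/-! ### The strip class of the free evolution -/

section FreeStrip

/-- **The free evolution of `L³` data lies in `L³` of every finite strip** `(0, S) × (EuclideanSpace ℝ (Fin 3))`, with
`∫∫ |e|³ ≤ S ‖u₀‖₃³` (`L³` contraction of the heat flow and Tonelli). [folklore] -/
theorem memLp_uncurry_heatFlow_strip {u₀ : (EuclideanSpace ℝ (Fin 3)) → (EuclideanSpace ℝ (Fin 3))} (hu₀ : MemLp u₀ 3 volume) {ν : ℝ} (hν : 0 < ν)
    (S : ℝ) :
    MemLp (uncurry fun (t : ℝ) (x : (EuclideanSpace ℝ (Fin 3))) => heatFlow u₀ (ν * t) x) 3 (volume.restrict (Ioo 0 S ×ˢ univ)) ∧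
      ∫⁻ z in Ioo 0 S ×ˢ (univ : Set (EuclideanSpace ℝ (Fin 3))), ‖heatFlow u₀ (ν * z.1) z.2‖ₑ ^ (3 : ℝ) ≤
        ENNReal.ofReal S * eLpNorm u₀ 3 volume ^ (3 : ℝ) := by
  have hmeas := aestronglyMeasurable_uncurry_heatFlow hu₀ (by norm_num) hν S
  have hbound : ∫⁻ z in Ioo 0 S ×ˢ (univ : Set (EuclideanSpace ℝ (Fin 3))), ‖heatFlow u₀ (ν * z.1) z.2‖ₑ ^ (3 : ℝ) ≤
      ENNReal.ofReal S * eLpNorm u₀ 3 volume ^ (3 : ℝ) := by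
    rw [volume_restrict_prod_univ_eq_prod]
    calc ∫⁻ z, ‖heatFlow u₀ (ν * z.1) z.2‖ₑ ^ (3 : ℝ) ∂((volume.restrict (Ioo 0 S)).prod volume)
        ≤ ∫⁻ t in Ioo 0 S, ∫⁻ x, ‖heatFlow u₀ (ν * t) x‖ₑ ^ (3 : ℝ) :=
          lintegral_prod_le (μ := volume.restrict (Ioo 0 S)) (ν := (volume : Measure (EuclideanSpace ℝ (Fin 3))))
            (fun z : ℝ × (EuclideanSpace ℝ (Fin 3)) => ‖heatFlow u₀ (ν * z.1) z.2‖ₑ ^ (3 : ℝ))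
      _ ≤ ∫⁻ _ in Ioo 0 S, eLpNorm u₀ 3 volume ^ (3 : ℝ) := by
          refine lintegral_mono_ae ((ae_restrict_mem measurableSet_Ioo).mono fun t ht => ?_)
          rw [lintegral_enorm_rpow_three_eq]
          exact ENNReal.rpow_le_rpow (eLpNorm_heatFlow_le_holds hu₀ (by norm_num)
            (mul_nonneg hν.le ht.1.le)) (by norm_num)
      _ = ENNReal.ofReal S * eLpNorm u₀ 3 volume ^ (3 : ℝ) := by
          rw [setLIntegral_const, Real.volume_Ioo, sub_zero, mul_comm]
  refine ⟨memLp_of_lintegral_rpow_lt_top (by norm_num) (by norm_num) hmeas ?_, hbound⟩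
  have h3 : (3 : ℝ≥0∞).toReal = 3 := by norm_num
  rw [h3]
  refine lt_of_le_of_lt hbound (ENNReal.mul_lt_top ENNReal.ofReal_lt_top ?_)
  exact ENNReal.rpow_lt_top_of_nonneg (by norm_num) hu₀.eLpNorm_ne_top

/-- `∫ |f|³ = ‖f‖₃³` for `f ∈ L³` (real form). [folklore] -/
theorem integral_norm_pow_three_eq {X : Type*} [MeasureSpace X] {F : Type*} [NormedAddCommGroup F]
    {f : X → F} (hf : MemLp f 3 (volume : Measure X)) :
    ∫ x, ‖f x‖ ^ 3 = (eLpNorm f 3 (volume : Measure X)).toReal ^ 3 := by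
  have hint : Integrable (fun x => ‖f x‖ ^ 3) (volume : Measure X) := hf.integrable_norm_pow (by norm_num)
  have h1 : ENNReal.ofReal (∫ x, ‖f x‖ ^ 3) = ∫⁻ x, ‖f x‖ₑ ^ (3 : ℝ) := by
    rw [ofReal_integral_eq_lintegral_ofReal hint (Eventually.of_forall fun _ => by positivity)]
    refine lintegral_congr fun x => ?_
    rw [← ofReal_norm, ENNReal.ofReal_pow (norm_nonneg _), ENNReal.rpow_ofNat]
  have h3 : ∫ x, ‖f x‖ ^ 3 = (ENNReal.ofReal (∫ x, ‖f x‖ ^ 3)).toReal :=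
    (ENNReal.toReal_ofReal (integral_nonneg fun _ => by positivity)).symm
  rw [h3, h1, lintegral_enorm_rpow_three_eq, ← ENNReal.toReal_rpow, Real.rpow_ofNat]

end FreeStrip

/-! ### The tested inequality -/

section Main

variable {S ν M : ℝ} {u₀ : (EuclideanSpace ℝ (Fin 3)) → (EuclideanSpace ℝ (Fin 3))} {u : ℝ → (EuclideanSpace ℝ (Fin 3)) → (EuclideanSpace ℝ (Fin 3))} {p : ℝ → (EuclideanSpace ℝ (Fin 3)) → ℝ}
  {G : ℝ → (EuclideanSpace ℝ (Fin 3)) → (EuclideanSpace ℝ (Fin 3)) →L[ℝ] (EuclideanSpace ℝ (Fin 3))}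

set_option maxHeartbeats 3200000 in
/-- **The energy inequality of the caloric remainder tested with `η(t) χ_R(x)`**
(Rusin–Šverák 2011, §4 p. 6; Lemarié-Rieusset 2016, proof of Thm. 14.7, pp. 516–518 with the test
function `γ(s)φ₀(x)` of the proof of Thm. 14.2, p. 499). In the setting of the module docstring:
there is `Err ≥ 0` (depending on `ν`, `S`, `M`, the strip norms of `u`, `p`, `u₀` and the cut-off
profile, but not on the time weight nor on the radius) such that for all `0 < t₁ ≤ t₂ < S`, every
smooth `η` with `0 ≤ η ≤ 1` supported in `[t₁, t₂]`, and every `R > 0`,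
`ν ∫ η g_R ≤ ∫ η' y_R + ∫ η (α y_R) + ∫ η β₀ + Err/R` with `y_R(t) = ∫ |u(t) - e^{νtΔ}u₀|² χ_R`,
`g_R(t) = ∫ |G(t) - D e^{νtΔ}u₀|² χ_R`, `α(t) = 2·2^{3/2} (νt)^{-1/2} M`, `β₀ = M ∫|u₀|³/ν`.
[cite: LemarieRieusset2016, Thm. 14.7, proof pp. 516–518] [cite: RusinSverak2011, §4 p. 6] -/
theorem caloric_remainder_tested_inequality (hν : 0 < ν) (hS : 0 < S) (hM0 : 0 ≤ M)
    (hMb : ∀ x, ‖u₀ x‖ ≤ M) (hu₀ : MemLp u₀ 3 volume) (hdiv₀ : IsWeaklyDivFree u₀)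
    (hNS : IsDistributionalNSSolutionOn (slab (EuclideanSpace ℝ (Fin 3)) (Ioo 0 S) isOpen_Ioo) ν 0 u p)
    (hG : HasWeakSpatialGradientOn (slab (EuclideanSpace ℝ (Fin 3)) (Ioo 0 S) isOpen_Ioo) u G)
    (hG2 : ∀ K ⊆ ((slab (EuclideanSpace ℝ (Fin 3)) (Ioo 0 S) isOpen_Ioo : Opens (ℝ × (EuclideanSpace ℝ (Fin 3)))) : Set (ℝ × (EuclideanSpace ℝ (Fin 3)))), IsCompact K →
      ∫⁻ z in K, ENNReal.ofReal (frobeniusNormSq (G z.1 z.2)) < ∞)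
    (hLEI : ∀ φ : ℝ → (EuclideanSpace ℝ (Fin 3)) → ℝ, IsSpaceTimeTestOn (slab (EuclideanSpace ℝ (Fin 3)) (Ioo 0 S) isOpen_Ioo) φ → (∀ t x, 0 ≤ φ t x) →
      2 * ν * ∫ t, ∫ x, frobeniusNormSq (G t x) * φ t x ≤
        ∫ t, ∫ x, (‖u t x‖ ^ 2 * (timeDeriv φ t x + ν * Δ (φ t) x) +
          (‖u t x‖ ^ 2 + 2 * p t x) * ⟪u t x, gradient (φ t) x⟫ +
          2 * ⟪(0 : ℝ → (EuclideanSpace ℝ (Fin 3)) → (EuclideanSpace ℝ (Fin 3))) t x, u t x⟫ * φ t x))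
    (hu3 : MemLp (uncurry u) 3 (volume.restrict (Ioo 0 S ×ˢ univ)))
    (hp32 : MemLp (uncurry p) (3 / 2) (volume.restrict (Ioo 0 S ×ˢ univ)))
    (hcont : ContinuousInLpOn (Ico 0 S) 3 u) :
    ∃ Err : ℝ, 0 ≤ Err ∧ ∀ (t₁ t₂ : ℝ), 0 < t₁ → t₁ ≤ t₂ → t₂ < S →
      ∀ η : ℝ → ℝ, ContDiff ℝ (⊤ : ℕ∞) η → (∀ t, 0 ≤ η t) → (∀ t, η t ≤ 1) → support η ⊆ Icc t₁ t₂ →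
      ∀ R : ℝ, 0 < R →
        ν * ∫ t, η t * ∫ x, frobeniusNormSq (G t x - fderiv ℝ (heatFlow u₀ (ν * t)) x) * cutoff R x ≤
          (∫ t, deriv η t * ∫ x, ‖u t x - heatFlow u₀ (ν * t) x‖ ^ 2 * cutoff R x) +
          (∫ t, η t * ((2 * (2 ^ ((3 : ℝ) / 2) * (ν * t) ^ (-(1 / 2 : ℝ)) * M)) *
              ∫ x, ‖u t x - heatFlow u₀ (ν * t) x‖ ^ 2 * cutoff R x)) +
          (∫ t, η t * (M * (∫ x, ‖u₀ x‖ ^ 3) / ν)) + Err / R := by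
  -- ### constants of the cut-off profile and of the free evolution
  obtain ⟨C₁, hC₁0, hC₁⟩ := exists_norm_fderiv_cutoff_le (E := (EuclideanSpace ℝ (Fin 3)))
  obtain ⟨C₂, hC₂0, hC₂⟩ := exists_abs_laplacian_cutoff_le (E := (EuclideanSpace ℝ (Fin 3)))
  set N3 : ℝ := ∫ x, ‖u₀ x‖ ^ 3 with hN3
  have hN30 : 0 ≤ N3 := integral_nonneg fun _ => by positivity
  -- the strip and the classes on it
  set strip : Set (ℝ × (EuclideanSpace ℝ (Fin 3))) := Ioo 0 S ×ˢ (univ : Set (EuclideanSpace ℝ (Fin 3))) with hstrip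
  have hstrip_m : MeasurableSet strip := measurableSet_Ioo.prod MeasurableSet.univ
  obtain ⟨he3, he3b⟩ := memLp_uncurry_heatFlow_strip hu₀ hν S
  have hw3 : MemLp (fun z : ℝ × (EuclideanSpace ℝ (Fin 3)) => u z.1 z.2 - heatFlow u₀ (ν * z.1) z.2) 3 (volume.restrict strip) :=
    hu3.sub he3
  -- the dominating function `Ψ = |u|³ + |w|³ + |e|³ + |p|^{3/2}` on the strip
  set Ψ : ℝ × (EuclideanSpace ℝ (Fin 3)) → ℝ := fun z => ‖u z.1 z.2‖ ^ 3 + ‖u z.1 z.2 - heatFlow u₀ (ν * z.1) z.2‖ ^ 3 +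
    ‖heatFlow u₀ (ν * z.1) z.2‖ ^ 3 + ‖p z.1 z.2‖ ^ (3 / 2 : ℝ) with hΨ
  have hΨi : IntegrableOn Ψ strip volume := by
    have h1 : IntegrableOn (fun z : ℝ × (EuclideanSpace ℝ (Fin 3)) => ‖u z.1 z.2‖ ^ 3) strip volume := hu3.integrable_norm_pow (by norm_num)
    have h2 : IntegrableOn (fun z : ℝ × (EuclideanSpace ℝ (Fin 3)) => ‖u z.1 z.2 - heatFlow u₀ (ν * z.1) z.2‖ ^ 3) strip volume :=
      hw3.integrable_norm_pow (by norm_num)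
    have h3 : IntegrableOn (fun z : ℝ × (EuclideanSpace ℝ (Fin 3)) => ‖heatFlow u₀ (ν * z.1) z.2‖ ^ 3) strip volume :=
      he3.integrable_norm_pow (by norm_num)
    have h4 : IntegrableOn (fun z : ℝ × (EuclideanSpace ℝ (Fin 3)) => ‖p z.1 z.2‖ ^ (3 / 2 : ℝ)) strip volume := by
      have := hp32.integrable_norm_rpow (ENNReal.div_pos (by norm_num) (by norm_num)).ne'
        (ENNReal.div_ne_top (by norm_num) (by norm_num))
      have e : ((3 : ℝ≥0∞) / 2).toReal = 3 / 2 := by rw [ENNReal.toReal_div]; norm_num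
      rw [e] at this
      exact this
    exact ((h1.add h2).add h3).add h4
  have hΨ0 : ∀ z, 0 ≤ Ψ z := fun z => by positivity
  set IΨ : ℝ := ∫ z in strip, Ψ z with hIΨ
  have hIΨ0 : 0 ≤ IΨ := setIntegral_nonneg hstrip_m fun z _ => hΨ0 z
  -- the constant of the `Δχ_R` term (Young with the parameter `R^{-1/3}`, no Hölder)
  set V₁ : ℝ := (volume (closedBall (0 : (EuclideanSpace ℝ (Fin 3))) 1)).toReal with hV₁
  have hV₁0 : 0 ≤ V₁ := ENNReal.toReal_nonneg
  set A₀ : ℝ := (2 / 3) * IΨ + (8 / 3) * C₂ ^ 3 * S * V₁ with hA₀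
  have hA₀0 : 0 ≤ A₀ := by positivity
  -- ### the error constant
  refine ⟨8 * C₁ * IΨ + ν * A₀, by positivity, ?_⟩
  intro t₁ t₂ ht₁ ht₁₂ ht₂S η hη hη0 hη1 hηs R hR
  -- ### the test function and the smooth caloric field
  set χ : (EuclideanSpace ℝ (Fin 3)) → ℝ := cutoff R with hχ
  have hχs : ContDiff ℝ (⊤ : ℕ∞) χ := contDiff_cutoff R
  have hχc : HasCompactSupport χ := hasCompactSupport_cutoff hR
  have hχ0 : ∀ x, 0 ≤ χ x := fun x => cutoff_nonneg R x
  have hχ1 : ∀ x, χ x ≤ 1 := fun x => cutoff_le_one R x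
  have hχz : ∀ x : (EuclideanSpace ℝ (Fin 3)), 2 * R < ‖x‖ → χ x = 0 := fun x hx => cutoff_eq_zero hR hx.le
  have hDχ : ∀ x, ‖fderiv ℝ χ x‖ ≤ C₁ / R := hC₁ R hR
  have hΔχ : ∀ x, |(Δ χ) x| ≤ C₂ / R ^ 2 := hC₂ R hR
  set φ : ℝ → (EuclideanSpace ℝ (Fin 3)) → ℝ := fun t x => η t * χ x with hφdef
  have hΩ' : (slab (EuclideanSpace ℝ (Fin 3)) (Ioo (t₁ / 2) S) isOpen_Ioo : Opens (ℝ × (EuclideanSpace ℝ (Fin 3)))) ≤ slab (EuclideanSpace ℝ (Fin 3)) (Ioo 0 S) isOpen_Ioo :=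
    slab_mono (Ioo_subset_Ioo (by positivity) le_rfl)
  have hφ : IsSpaceTimeTestOn (slab (EuclideanSpace ℝ (Fin 3)) (Ioo (t₁ / 2) S) isOpen_Ioo) φ :=
    isSpaceTimeTestOn_mul_of_support_subset hη hηs (by linarith) ht₂S hχs hχc
  have hφ0 : ∀ t x, 0 ≤ φ t x := fun t x => mul_nonneg (hη0 t) (hχ0 x)
  set τ : ℝ := t₁ with hτ
  have hτ0 : 0 < τ := ht₁
  set Ec : ℝ → (EuclideanSpace ℝ (Fin 3)) → (EuclideanSpace ℝ (Fin 3)) := fun t x => smoothTransition (4 * t / τ - 1) • heatFlow u₀ (ν * t) x with hEc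
  have hEcs : ContDiff ℝ (⊤ : ℕ∞) (uncurry Ec) := contDiff_uncurry_cutoffHeatFlow hu₀ (by norm_num) hν hτ0
  have hEcheat : ∀ z ∈ ((slab (EuclideanSpace ℝ (Fin 3)) (Ioo (t₁ / 2) S) isOpen_Ioo : Opens (ℝ × (EuclideanSpace ℝ (Fin 3)))) : Set (ℝ × (EuclideanSpace ℝ (Fin 3)))),
      HasDerivAt (fun s => Ec s z.2) (ν • (Δ (Ec z.1)) z.2) z.1 := by
    intro z hz
    have hz1 : τ / 2 < z.1 := (mem_slab.1 hz).1
    exact hasDerivAt_cutoffHeatFlow_time hu₀ (by norm_num) hν hτ0 hz1 z.2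
  have hEcdiv : ∀ t, VectorCalculus.IsDivFree (Ec t) := fun t =>
    isDivFree_cutoffHeatFlow hdiv₀ hu₀ (by norm_num) hν hτ0 t
  -- ### the local energy inequality of the remainder, tested with `φ`
  have hG2' : ∀ K ⊆ ((slab (EuclideanSpace ℝ (Fin 3)) (Ioo (t₁ / 2) S) isOpen_Ioo : Opens (ℝ × (EuclideanSpace ℝ (Fin 3)))) : Set (ℝ × (EuclideanSpace ℝ (Fin 3)))), IsCompact K →
      ∫⁻ z in K, ENNReal.ofReal (frobeniusNormSq (G z.1 z.2)) < ∞ := fun K hK hKc => hG2 K (hK.trans hΩ') hKc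
  have hLEI' : ∀ ψ : ℝ → (EuclideanSpace ℝ (Fin 3)) → ℝ, IsSpaceTimeTestOn (slab (EuclideanSpace ℝ (Fin 3)) (Ioo (t₁ / 2) S) isOpen_Ioo) ψ → (∀ t x, 0 ≤ ψ t x) →
      2 * ν * ∫ t, ∫ x, frobeniusNormSq (G t x) * ψ t x ≤
        ∫ t, ∫ x, (‖u t x‖ ^ 2 * (timeDeriv ψ t x + ν * Δ (ψ t) x) +
          (‖u t x‖ ^ 2 + 2 * p t x) * ⟪u t x, gradient (ψ t) x⟫ +
          2 * ⟪(0 : ℝ → (EuclideanSpace ℝ (Fin 3)) → (EuclideanSpace ℝ (Fin 3))) t x, u t x⟫ * ψ t x) := fun ψ hψ hψ0 => hLEI ψ (hψ.mono hΩ') hψ0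
  have hKstrip : ∀ K ⊆ ((slab (EuclideanSpace ℝ (Fin 3)) (Ioo (t₁ / 2) S) isOpen_Ioo : Opens (ℝ × (EuclideanSpace ℝ (Fin 3)))) : Set (ℝ × (EuclideanSpace ℝ (Fin 3)))), K ⊆ strip := by
    intro K hK z hz
    exact ⟨mem_slab.1 (hΩ' (hK hz)), mem_univ _⟩
  have hu3' : ∀ K ⊆ ((slab (EuclideanSpace ℝ (Fin 3)) (Ioo (t₁ / 2) S) isOpen_Ioo : Opens (ℝ × (EuclideanSpace ℝ (Fin 3)))) : Set (ℝ × (EuclideanSpace ℝ (Fin 3)))), IsCompact K →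
      MemLp (uncurry u) 3 (volume.restrict K) := fun K hK _ =>
    hu3.mono_measure (Measure.restrict_mono (hKstrip K hK) le_rfl)
  have hp32' : ∀ K ⊆ ((slab (EuclideanSpace ℝ (Fin 3)) (Ioo (t₁ / 2) S) isOpen_Ioo : Opens (ℝ × (EuclideanSpace ℝ (Fin 3)))) : Set (ℝ × (EuclideanSpace ℝ (Fin 3)))), IsCompact K →
      MemLp (uncurry p) (3 / 2) (volume.restrict K) := fun K hK _ =>
    hp32.mono_measure (Measure.restrict_mono (hKstrip K hK) le_rfl)
  have h5 := caloric_remainder_energy_inequality (hNS.of_le hΩ') (hG.mono hΩ') hG2' hLEI' hu3' hp32' hEcs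
    hEcheat hEcdiv hφ hφ0 hν
  -- ### the weights and the identification `Ec = e` on the support of `η`
  have hφt : ∀ t x, timeDeriv φ t x = deriv η t * χ x := fun t x =>
    timeDeriv_mul_const_space χ (hη.differentiable (by simp)) t x
  have hφg : ∀ t x, gradient (φ t) x = η t • gradient χ x := fun t x =>
    gradient_mul_const_time η t ((hχs.differentiable (by simp)) x)
  have hφL : ∀ t x, (Δ (φ t)) x = η t * (Δ χ) x := fun t x =>
    laplacian_mul_const_time η (contDiff_infty.1 hχs 2) t x
  have hη_lt : ∀ t, t < t₁ → η t = 0 ∧ deriv η t = 0 := by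
    intro t ht
    have hev : η =ᶠ[𝓝 t] fun _ => (0 : ℝ) := by
      filter_upwards [(isOpen_gt' t₁).mem_nhds ht] with s hs
      by_contra h
      exact absurd (hηs (mem_support.2 h)).1 (not_le.2 hs)
    exact ⟨hev.self_of_nhds, by rw [hev.deriv_eq, deriv_const]⟩
  have hEc_eq : ∀ t, t₁ ≤ t → Ec t = heatFlow u₀ (ν * t) := fun t ht =>
    funext fun x => cutoffHeatFlow_eq_of_le hτ0 (by rw [hτ]; linarith) x
  have h5e : ν * ∫ t, ∫ x, frobeniusNormSq (G t x - fderiv ℝ (heatFlow u₀ (ν * t)) x) * (η t * χ x) ≤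
      (∫ t, ∫ x, ‖u t x - heatFlow u₀ (ν * t) x‖ ^ 2 * (deriv η t * χ x + ν * (η t * (Δ χ) x))) +
        (∫ t, ∫ x, (‖u t x - heatFlow u₀ (ν * t) x‖ ^ 2 - ‖heatFlow u₀ (ν * t) x‖ ^ 2) *
          ⟪u t x, η t • gradient χ x⟫) +
        2 * (∫ t, ∫ x, p t x * ⟪u t x - heatFlow u₀ (ν * t) x, η t • gradient χ x⟫) +
        2 * (∫ t, ∫ x, (η t * χ x) * (‖fderiv ℝ (heatFlow u₀ (ν * t)) x‖ * ‖u t x - heatFlow u₀ (ν * t) x‖ ^ 2)) +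
        1 / ν * (∫ t, ∫ x, (η t * χ x) * ‖heatFlow u₀ (ν * t) x‖ ^ 4) +
        (∫ t, ∫ x, ‖heatFlow u₀ (ν * t) x‖ ^ 2 * ⟪u t x - heatFlow u₀ (ν * t) x, η t • gradient χ x⟫) +
        2 * (∫ t, ∫ x, ⟪heatFlow u₀ (ν * t) x, η t • gradient χ x⟫ *
          ⟪heatFlow u₀ (ν * t) x, u t x - heatFlow u₀ (ν * t) x⟫) +
        ∫ t, ∫ x, ⟪heatFlow u₀ (ν * t) x, η t • gradient χ x⟫ * ‖heatFlow u₀ (ν * t) x‖ ^ 2 := by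
    have e0 : ν * ∫ t, ∫ x, frobeniusNormSq (G t x - fderiv ℝ (heatFlow u₀ (ν * t)) x) * (η t * χ x) =
        ν * ∫ t, ∫ x, frobeniusNormSq (G t x - fderiv ℝ (Ec t) x) * φ t x := by
      congr 1
      refine integral_congr_ae (ae_of_all _ fun t => integral_congr_ae (ae_of_all _ fun x => ?_))
      rcases lt_or_ge t t₁ with ht | ht
      · obtain ⟨h0, h0'⟩ := hη_lt t ht
        simp only
        simp only [hφdef, h0, zero_mul, mul_zero]
      · simp only
        simp only [hEc_eq t ht, hφdef]
    have e1 : (∫ t, ∫ x, ‖u t x - heatFlow u₀ (ν * t) x‖ ^ 2 * (deriv η t * χ x + ν * (η t * (Δ χ) x))) =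
        (∫ t, ∫ x, ‖u t x - Ec t x‖ ^ 2 * (timeDeriv φ t x + ν * Δ (φ t) x)) := by
      refine integral_congr_ae (ae_of_all _ fun t => integral_congr_ae (ae_of_all _ fun x => ?_))
      rcases lt_or_ge t t₁ with ht | ht
      · obtain ⟨h0, h0'⟩ := hη_lt t ht
        simp only [hφt, hφL]
        simp only [h0, h0', zero_mul, mul_zero, add_zero]
      · simp only [hφt, hφL]
        simp only [hEc_eq t ht]
    have e2 : (∫ t, ∫ x, (‖u t x - heatFlow u₀ (ν * t) x‖ ^ 2 - ‖heatFlow u₀ (ν * t) x‖ ^ 2) *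
          ⟪u t x, η t • gradient χ x⟫) =
        (∫ t, ∫ x, (‖u t x - Ec t x‖ ^ 2 - ‖Ec t x‖ ^ 2) * ⟪u t x, gradient (φ t) x⟫) := by
      refine integral_congr_ae (ae_of_all _ fun t => integral_congr_ae (ae_of_all _ fun x => ?_))
      rcases lt_or_ge t t₁ with ht | ht
      · obtain ⟨h0, h0'⟩ := hη_lt t ht
        simp only [hφg]
        simp only [h0, mul_zero, zero_smul, inner_zero_right]
      · simp only [hφg]
        simp only [hEc_eq t ht]
    have e3 : (∫ t, ∫ x, p t x * ⟪u t x - heatFlow u₀ (ν * t) x, η t • gradient χ x⟫) =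
        (∫ t, ∫ x, p t x * ⟪u t x - Ec t x, gradient (φ t) x⟫) := by
      refine integral_congr_ae (ae_of_all _ fun t => integral_congr_ae (ae_of_all _ fun x => ?_))
      rcases lt_or_ge t t₁ with ht | ht
      · obtain ⟨h0, h0'⟩ := hη_lt t ht
        simp only [hφg]
        simp only [h0, mul_zero, zero_smul, inner_zero_right]
      · simp only [hφg]
        simp only [hEc_eq t ht]
    have e4 : (∫ t, ∫ x, (η t * χ x) * (‖fderiv ℝ (heatFlow u₀ (ν * t)) x‖ * ‖u t x - heatFlow u₀ (ν * t) x‖ ^ 2)) =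
        (∫ t, ∫ x, φ t x * (‖fderiv ℝ (Ec t) x‖ * ‖u t x - Ec t x‖ ^ 2)) := by
      refine integral_congr_ae (ae_of_all _ fun t => integral_congr_ae (ae_of_all _ fun x => ?_))
      rcases lt_or_ge t t₁ with ht | ht
      · obtain ⟨h0, h0'⟩ := hη_lt t ht
        simp only
        simp only [hφdef, h0, zero_mul]
      · simp only
        simp only [hEc_eq t ht, hφdef]
    have e5 : (∫ t, ∫ x, (η t * χ x) * ‖heatFlow u₀ (ν * t) x‖ ^ 4) =
        (∫ t, ∫ x, φ t x * ‖Ec t x‖ ^ 4) := by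
      refine integral_congr_ae (ae_of_all _ fun t => integral_congr_ae (ae_of_all _ fun x => ?_))
      rcases lt_or_ge t t₁ with ht | ht
      · obtain ⟨h0, h0'⟩ := hη_lt t ht
        simp only
        simp only [hφdef, h0, zero_mul]
      · simp only
        simp only [hEc_eq t ht, hφdef]
    have e6 : (∫ t, ∫ x, ‖heatFlow u₀ (ν * t) x‖ ^ 2 * ⟪u t x - heatFlow u₀ (ν * t) x, η t • gradient χ x⟫) =
        (∫ t, ∫ x, ‖Ec t x‖ ^ 2 * ⟪u t x - Ec t x, gradient (φ t) x⟫) := by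
      refine integral_congr_ae (ae_of_all _ fun t => integral_congr_ae (ae_of_all _ fun x => ?_))
      rcases lt_or_ge t t₁ with ht | ht
      · obtain ⟨h0, h0'⟩ := hη_lt t ht
        simp only [hφg]
        simp only [h0, mul_zero, zero_smul, inner_zero_right]
      · simp only [hφg]
        simp only [hEc_eq t ht]
    have e7 : (∫ t, ∫ x, ⟪heatFlow u₀ (ν * t) x, η t • gradient χ x⟫ *
          ⟪heatFlow u₀ (ν * t) x, u t x - heatFlow u₀ (ν * t) x⟫) =
        (∫ t, ∫ x, ⟪Ec t x, gradient (φ t) x⟫ * ⟪Ec t x, u t x - Ec t x⟫) := by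
      refine integral_congr_ae (ae_of_all _ fun t => integral_congr_ae (ae_of_all _ fun x => ?_))
      rcases lt_or_ge t t₁ with ht | ht
      · obtain ⟨h0, h0'⟩ := hη_lt t ht
        simp only [hφg]
        simp only [h0, zero_mul, zero_smul, inner_zero_right]
      · simp only [hφg]
        simp only [hEc_eq t ht]
    have e8 : (∫ t, ∫ x, ⟪heatFlow u₀ (ν * t) x, η t • gradient χ x⟫ * ‖heatFlow u₀ (ν * t) x‖ ^ 2) =
        (∫ t, ∫ x, ⟪Ec t x, gradient (φ t) x⟫ * ‖Ec t x‖ ^ 2) := by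
      refine integral_congr_ae (ae_of_all _ fun t => integral_congr_ae (ae_of_all _ fun x => ?_))
      rcases lt_or_ge t t₁ with ht | ht
      · obtain ⟨h0, h0'⟩ := hη_lt t ht
        simp only [hφg]
        simp only [h0, zero_mul, zero_smul, inner_zero_right]
      · simp only [hφg]
        simp only [hEc_eq t ht]
    rw [e0, e1, e2, e3, e4, e5, e6, e7, e8]
    exact h5
  -- ### notation for the slices
  have hη_gt : ∀ t, t₂ < t → η t = 0 ∧ deriv η t = 0 := by
    intro t ht
    have hev : η =ᶠ[𝓝 t] fun _ => (0 : ℝ) := by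
      filter_upwards [(isOpen_lt' t₂).mem_nhds ht] with s hs
      by_contra h
      exact absurd (hηs (mem_support.2 h)).2 (not_le.2 hs)
    exact ⟨hev.self_of_nhds, by rw [hev.deriv_eq, deriv_const]⟩
  have hη_out : ∀ t, t ∉ Icc t₁ t₂ → η t = 0 ∧ deriv η t = 0 := by
    intro t ht
    rw [mem_Icc, not_and_or, not_le, not_le] at ht
    rcases ht with ht | ht
    exacts [hη_lt t ht, hη_gt t ht]
  have hηc : HasCompactSupport η := HasCompactSupport.of_support_subset_isCompact isCompact_Icc hηs
  obtain ⟨Cη', hCη'⟩ := (hη.continuous_deriv (by simp)).bounded_above_of_compact_support hηc.deriv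
  have hCη'0 : 0 ≤ Cη' := le_trans (norm_nonneg _) (hCη' 0)
  -- the bounded caloric field and its gradient on `t ≥ t₁`
  have heM : ∀ t x, ‖heatFlow u₀ (ν * t) x‖ ≤ M := fun t x => norm_heatFlow_le hMb _ x
  set D₁ : ℝ := 2 ^ ((3 : ℝ) / 2) * (ν * t₁) ^ (-(1 / 2 : ℝ)) * M with hD₁
  have hD₁0 : 0 ≤ D₁ := by positivity
  have hDe : ∀ t, 0 < t → ∀ x, ‖fderiv ℝ (heatFlow u₀ (ν * t)) x‖ ≤ 2 ^ ((3 : ℝ) / 2) * (ν * t) ^ (-(1 / 2 : ℝ)) * M := by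
    intro t ht x
    have h := norm_fderiv_heatFlow_le_of_bound hu₀.aestronglyMeasurable hMb (mul_pos hν ht) x
    rwa [finrank_euclideanSpace_fin] at h
  have hDe₁ : ∀ t, t₁ ≤ t → ∀ x, ‖fderiv ℝ (heatFlow u₀ (ν * t)) x‖ ≤ D₁ := by
    intro t ht x
    refine (hDe t (lt_of_lt_of_le ht₁ ht) x).trans ?_
    have hr : (ν * t) ^ (-(1 / 2 : ℝ)) ≤ (ν * t₁) ^ (-(1 / 2 : ℝ)) :=
      Real.rpow_le_rpow_of_nonpos (mul_pos hν ht₁) (mul_le_mul_of_nonneg_left ht hν.le) (by norm_num)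
    rw [hD₁]
    exact mul_le_mul_of_nonneg_right (mul_le_mul_of_nonneg_left hr (by positivity)) hM0
  -- slices of `w` on `[t₁, t₂]`
  have hwt : ∀ t ∈ Icc t₁ t₂, MemLp (fun x => u t x - heatFlow u₀ (ν * t) x) 3 volume := by
    intro t ht
    have hut : MemLp (u t) 3 volume := hcont.1 t ⟨ht₁.le.trans ht.1, lt_of_le_of_lt ht.2 ht₂S⟩
    exact hut.sub (memLp_heatFlow_holds hu₀ (by norm_num) (by nlinarith [ht.1]))
  have het : ∀ t, MemLp (heatFlow u₀ (ν * t)) 3 volume := fun t => by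
    rcases le_or_gt (ν * t) 0 with h | h
    · rw [heatFlow_of_nonpos _ h]; exact hu₀
    · exact memLp_heatFlow_holds hu₀ (by norm_num) h.le
  -- a slice-integrability tool: `|w(t)|² ω` for a bounded weight supported in `B̄(0, 2R)`
  have hball : volume (closedBall (0 : (EuclideanSpace ℝ (Fin 3))) (2 * R)) < ∞ := measure_closedBall_lt_top
  have slice_int : ∀ t ∈ Icc t₁ t₂, ∀ {ω : (EuclideanSpace ℝ (Fin 3)) → ℝ} {Cω : ℝ}, AEStronglyMeasurable ω volume →
      (∀ x, |ω x| ≤ Cω) → (∀ x, 2 * R < ‖x‖ → ω x = 0) →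
      Integrable (fun x => ‖u t x - heatFlow u₀ (ν * t) x‖ ^ 2 * ω x) volume := by
    intro t ht ω Cω hωm hωb hω0
    have hCω : 0 ≤ Cω := le_trans (abs_nonneg _) (hωb 0)
    have h3 : Integrable (fun x => ‖u t x - heatFlow u₀ (ν * t) x‖ ^ 3) volume := (hwt t ht).integrable_norm_pow (by norm_num)
    have hind : Integrable (indicator (closedBall (0 : (EuclideanSpace ℝ (Fin 3))) (2 * R)) (fun _ => (1 : ℝ))) volume :=
      (integrable_indicator_iff measurableSet_closedBall).2 (integrableOn_const (hs := hball.ne))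
    refine Integrable.mono' ((h3.add hind).const_mul Cω)
      (((hwt t ht).aestronglyMeasurable.norm.pow 2).mul hωm) (Eventually.of_forall fun x => ?_)
    rw [norm_mul, Real.norm_eq_abs, abs_of_nonneg (sq_nonneg _), Real.norm_eq_abs]
    simp only [Pi.add_apply]
    by_cases hx : 2 * R < ‖x‖
    · rw [hω0 x hx, abs_zero, mul_zero]
      exact mul_nonneg hCω (add_nonneg (by positivity) (indicator_nonneg (fun _ _ => zero_le_one) _))
    · rw [indicator_of_mem (mem_closedBall_zero_iff.2 (not_lt.1 hx))]
      have hw0 := norm_nonneg (u t x - heatFlow u₀ (ν * t) x)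
      have h1 : ‖u t x - heatFlow u₀ (ν * t) x‖ ^ 2 ≤ ‖u t x - heatFlow u₀ (ν * t) x‖ ^ 3 + 1 := by
        nlinarith [sq_nonneg (‖u t x - heatFlow u₀ (ν * t) x‖ - 1), sq_nonneg ‖u t x - heatFlow u₀ (ν * t) x‖]
      calc ‖u t x - heatFlow u₀ (ν * t) x‖ ^ 2 * |ω x| ≤ (‖u t x - heatFlow u₀ (ν * t) x‖ ^ 3 + 1) * Cω :=
            mul_le_mul h1 (hωb x) (abs_nonneg _) (by positivity)
        _ = Cω * (‖u t x - heatFlow u₀ (ν * t) x‖ ^ 3 + 1) := by ring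
  have hχm : AEStronglyMeasurable χ volume := hχs.continuous.aestronglyMeasurable
  have hΔχm : AEStronglyMeasurable (fun x => (Δ χ) x) volume := (continuous_laplacian (contDiff_infty.1 hχs 2)).aestronglyMeasurable
  have hχb : ∀ x, |χ x| ≤ 1 := fun x => by rw [abs_of_nonneg (hχ0 x)]; exact hχ1 x
  have hΔχz : ∀ x : (EuclideanSpace ℝ (Fin 3)), 2 * R < ‖x‖ → (Δ χ) x = 0 := fun x hx => laplacian_cutoff_eq_zero_of_two_mul_lt hR hx
  -- ### per-slice evaluations
  set y : ℝ → ℝ := fun t => ∫ x, ‖u t x - heatFlow u₀ (ν * t) x‖ ^ 2 * χ x with hy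
  set zL : ℝ → ℝ := fun t => ∫ x, ‖u t x - heatFlow u₀ (ν * t) x‖ ^ 2 * (Δ χ) x with hzL
  have hT1 : ∀ t, ∫ x, ‖u t x - heatFlow u₀ (ν * t) x‖ ^ 2 * (deriv η t * χ x + ν * (η t * (Δ χ) x)) =
      deriv η t * y t + ν * (η t * zL t) := by
    intro t
    by_cases ht : t ∈ Icc t₁ t₂
    · have i1 := slice_int t ht hχm hχb hχz
      have i2 := slice_int t ht hΔχm hΔχ hΔχz
      rw [hy, hzL]
      dsimp only
      rw [← integral_const_mul, ← integral_const_mul, ← integral_const_mul, ← integral_add (i1.const_mul _) ((i2.const_mul _).const_mul _)]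
      exact integral_congr_ae (Eventually.of_forall fun x => by ring)
    · obtain ⟨h0, h0'⟩ := hη_out t ht
      simp [h0, h0']
  -- the coupling: `∫ ηχ ‖De‖ |w|² ≤ η(t) (2^{3/2} (νt)^{-1/2} M) y(t)`
  have hT4 : ∀ t, ∫ x, (η t * χ x) * (‖fderiv ℝ (heatFlow u₀ (ν * t)) x‖ * ‖u t x - heatFlow u₀ (ν * t) x‖ ^ 2) ≤
      η t * ((2 ^ ((3 : ℝ) / 2) * (ν * t) ^ (-(1 / 2 : ℝ)) * M) * y t) := by
    intro t
    by_cases ht : t ∈ Icc t₁ t₂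
    · have ht0 : 0 < t := lt_of_lt_of_le ht₁ ht.1
      rw [hy]
      dsimp only
      rw [← integral_const_mul, ← integral_const_mul]
      have i1 := slice_int t ht hχm hχb hχz
      refine integral_mono_of_nonneg (Eventually.of_forall fun x => ?_) ((i1.const_mul _).const_mul _)
        (Eventually.of_forall fun x => ?_)
      · exact mul_nonneg (mul_nonneg (hη0 t) (hχ0 x)) (mul_nonneg (norm_nonneg _) (sq_nonneg _))
      · have := hDe t ht0 x
        have hpos : 0 ≤ η t * χ x * ‖u t x - heatFlow u₀ (ν * t) x‖ ^ 2 := by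
          exact mul_nonneg (mul_nonneg (hη0 t) (hχ0 x)) (sq_nonneg _)
        calc η t * χ x * (‖fderiv ℝ (heatFlow u₀ (ν * t)) x‖ * ‖u t x - heatFlow u₀ (ν * t) x‖ ^ 2)
            = ‖fderiv ℝ (heatFlow u₀ (ν * t)) x‖ * (η t * χ x * ‖u t x - heatFlow u₀ (ν * t) x‖ ^ 2) := by ring
          _ ≤ (2 ^ ((3 : ℝ) / 2) * (ν * t) ^ (-(1 / 2 : ℝ)) * M) * (η t * χ x * ‖u t x - heatFlow u₀ (ν * t) x‖ ^ 2) :=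
              mul_le_mul_of_nonneg_right this hpos
          _ = η t * ((2 ^ ((3 : ℝ) / 2) * (ν * t) ^ (-(1 / 2 : ℝ)) * M) * (‖u t x - heatFlow u₀ (ν * t) x‖ ^ 2 * χ x)) := by ring
    · obtain ⟨h0, -⟩ := hη_out t ht
      simp [h0]
  -- the quartic term: `∫ ηχ |e|⁴ ≤ η(t) M ∫|u₀|³`
  have he3t : ∀ t, ∫ x, ‖heatFlow u₀ (ν * t) x‖ ^ 3 ≤ N3 := by
    intro t
    rw [integral_norm_pow_three_eq (het t), hN3, integral_norm_pow_three_eq hu₀]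
    have hle : eLpNorm (heatFlow u₀ (ν * t)) 3 volume ≤ eLpNorm u₀ 3 volume := by
      rcases le_or_gt (ν * t) 0 with h | h
      · rw [heatFlow_of_nonpos _ h]
      · exact eLpNorm_heatFlow_le_holds hu₀ (by norm_num) h.le
    exact pow_le_pow_left₀ ENNReal.toReal_nonneg (ENNReal.toReal_mono hu₀.eLpNorm_ne_top hle) 3
  have hT5 : ∀ t, ∫ x, (η t * χ x) * ‖heatFlow u₀ (ν * t) x‖ ^ 4 ≤ η t * (M * N3) := by
    intro t
    have i3 : Integrable (fun x => ‖heatFlow u₀ (ν * t) x‖ ^ 3) volume := (het t).integrable_norm_pow (by norm_num)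
    have hle : ∀ x, (η t * χ x) * ‖heatFlow u₀ (ν * t) x‖ ^ 4 ≤ η t * (M * ‖heatFlow u₀ (ν * t) x‖ ^ 3) := by
      intro x
      have h1 : ‖heatFlow u₀ (ν * t) x‖ ^ 4 ≤ M * ‖heatFlow u₀ (ν * t) x‖ ^ 3 := by
        have := heM t x
        nlinarith [pow_nonneg (norm_nonneg (heatFlow u₀ (ν * t) x)) 3]
      calc (η t * χ x) * ‖heatFlow u₀ (ν * t) x‖ ^ 4 ≤ (η t * 1) * (M * ‖heatFlow u₀ (ν * t) x‖ ^ 3) :=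
            mul_le_mul (mul_le_mul_of_nonneg_left (hχ1 x) (hη0 t)) h1 (by positivity) (mul_nonneg (hη0 t) zero_le_one)
        _ = η t * (M * ‖heatFlow u₀ (ν * t) x‖ ^ 3) := by ring
    calc ∫ x, (η t * χ x) * ‖heatFlow u₀ (ν * t) x‖ ^ 4 ≤ ∫ x, η t * (M * ‖heatFlow u₀ (ν * t) x‖ ^ 3) := by
          refine integral_mono_of_nonneg (Eventually.of_forall fun x => ?_) ((i3.const_mul M).const_mul _)
            (Eventually.of_forall hle)
          exact mul_nonneg (mul_nonneg (hη0 t) (hχ0 x)) (by positivity)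
      _ = η t * (M * ∫ x, ‖heatFlow u₀ (ν * t) x‖ ^ 3) := by rw [integral_const_mul, integral_const_mul]
      _ ≤ η t * (M * N3) := mul_le_mul_of_nonneg_left (mul_le_mul_of_nonneg_left (he3t t) hM0) (hη0 t)
  -- ### the compact box `Kc = [t₁, t₂] × B̄(0, 2R)` and vanishing of the weights off it
  set Kc : Set (ℝ × (EuclideanSpace ℝ (Fin 3))) := Icc t₁ t₂ ×ˢ closedBall (0 : (EuclideanSpace ℝ (Fin 3))) (2 * R) with hKc
  have hKcm : MeasurableSet Kc := measurableSet_Icc.prod measurableSet_closedBall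
  have hKcstrip : Kc ⊆ strip := fun z hz => ⟨⟨ht₁.trans_le hz.1.1, hz.1.2.trans_lt ht₂S⟩, mem_univ _⟩
  have hKcvol : volume Kc ≤ ENNReal.ofReal (S * ((2 * R) ^ 3 * V₁)) := by
    rw [hKc, show (volume : Measure (ℝ × (EuclideanSpace ℝ (Fin 3)))) = (volume : Measure ℝ).prod (volume : Measure (EuclideanSpace ℝ (Fin 3))) from rfl,
      Measure.prod_prod, Real.volume_Icc, Measure.addHaar_closedBall' _ _ (by positivity : (0 : ℝ) ≤ 2 * R),
      finrank_euclideanSpace_fin, hV₁, ENNReal.ofReal_mul hS.le, ENNReal.ofReal_mul (by positivity),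
      ENNReal.ofReal_toReal measure_closedBall_lt_top.ne]
    exact mul_le_mul' (ENNReal.ofReal_le_ofReal (by linarith)) le_rfl
  have hKcfin : volume Kc < ∞ := lt_of_le_of_lt hKcvol ENNReal.ofReal_lt_top
  have hind1 : Integrable (indicator Kc fun _ => (1 : ℝ)) (volume.restrict strip) :=
    ((integrable_indicator_iff hKcm).2 (integrableOn_const (hs := hKcfin.ne))).integrableOn
  have hχK : ∀ x : (EuclideanSpace ℝ (Fin 3)), x ∉ closedBall (0 : (EuclideanSpace ℝ (Fin 3))) (2 * R) → χ x = 0 ∧ gradient χ x = 0 ∧ (Δ χ) x = 0 := by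
    intro x hx
    rw [mem_closedBall_zero_iff, not_le] at hx
    refine ⟨hχz x hx, ?_, hΔχz x hx⟩
    rw [gradient, fderiv_cutoff_eq_zero_of_two_mul_lt hR hx, map_zero]
  have weightK : ∀ z : ℝ × (EuclideanSpace ℝ (Fin 3)), z ∉ Kc → (η z.1 = 0 ∧ deriv η z.1 = 0) ∨
      (χ z.2 = 0 ∧ gradient χ z.2 = 0 ∧ (Δ χ) z.2 = 0) := by
    intro z hz
    rw [hKc, mem_prod, not_and_or] at hz
    rcases hz with h | h
    exacts [Or.inl (hη_out z.1 h), Or.inr (hχK z.2 h)]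
  have offstrip : ∀ z : ℝ × (EuclideanSpace ℝ (Fin 3)), z ∉ strip → η z.1 = 0 ∧ deriv η z.1 = 0 := fun z hz =>
    hη_out z.1 fun h => hz ⟨⟨ht₁.trans_le h.1, h.2.trans_lt ht₂S⟩, mem_univ _⟩
  -- ### measurability on the strip
  have hum : AEStronglyMeasurable (fun z : ℝ × (EuclideanSpace ℝ (Fin 3)) => u z.1 z.2) (volume.restrict strip) := hu3.aestronglyMeasurable
  have hpm : AEStronglyMeasurable (fun z : ℝ × (EuclideanSpace ℝ (Fin 3)) => p z.1 z.2) (volume.restrict strip) := hp32.aestronglyMeasurable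
  have hem : AEStronglyMeasurable (fun z : ℝ × (EuclideanSpace ℝ (Fin 3)) => heatFlow u₀ (ν * z.1) z.2) (volume.restrict strip) :=
    he3.aestronglyMeasurable
  have hwm : AEStronglyMeasurable (fun z : ℝ × (EuclideanSpace ℝ (Fin 3)) => u z.1 z.2 - heatFlow u₀ (ν * z.1) z.2) (volume.restrict strip) :=
    hw3.aestronglyMeasurable
  have hDem : AEStronglyMeasurable (fun z : ℝ × (EuclideanSpace ℝ (Fin 3)) => fderiv ℝ (heatFlow u₀ (ν * z.1)) z.2) (volume.restrict strip) := by
    have hsm : IsSmoothSpaceTimeOn (Ioi 0) fun t x => heatFlow u₀ (ν * t) x :=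
      contDiffOn_uncurry_heatFlow hu₀ (by norm_num) hν
    have hc := (hsm.fderiv_slice isOpen_Ioi.uniqueDiffOn).continuousOn
    have hsub : strip ⊆ Ioi 0 ×ˢ (univ : Set (EuclideanSpace ℝ (Fin 3))) := prod_mono Ioo_subset_Ioi_self Subset.rfl
    exact (hc.mono hsub).aestronglyMeasurable hstrip_m
  have hηm : AEStronglyMeasurable (fun z : ℝ × (EuclideanSpace ℝ (Fin 3)) => η z.1) (volume.restrict strip) :=
    (hη.continuous.comp continuous_fst).aestronglyMeasurable
  have hη'm : AEStronglyMeasurable (fun z : ℝ × (EuclideanSpace ℝ (Fin 3)) => deriv η z.1) (volume.restrict strip) :=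
    ((hη.continuous_deriv (by simp)).comp continuous_fst).aestronglyMeasurable
  have hχm' : AEStronglyMeasurable (fun z : ℝ × (EuclideanSpace ℝ (Fin 3)) => χ z.2) (volume.restrict strip) :=
    (hχs.continuous.comp continuous_snd).aestronglyMeasurable
  have hΔχm' : AEStronglyMeasurable (fun z : ℝ × (EuclideanSpace ℝ (Fin 3)) => (Δ χ) z.2) (volume.restrict strip) :=
    ((continuous_laplacian (contDiff_infty.1 hχs 2)).comp continuous_snd).aestronglyMeasurable
  have hgχm' : AEStronglyMeasurable (fun z : ℝ × (EuclideanSpace ℝ (Fin 3)) => gradient χ z.2) (volume.restrict strip) :=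
    ((continuous_gradient_of_contDiff (contDiff_infty.1 hχs 1)).comp continuous_snd).aestronglyMeasurable
  -- the weights are bounded: `|η| ≤ 1`, `|η'| ≤ Cη'`, `|χ| ≤ 1`, `‖∇χ‖ ≤ C₁/R`, `|Δχ| ≤ C₂/R²`
  have hgχ : ∀ x, ‖gradient χ x‖ ≤ C₁ / R := fun x => by
    rw [gradient, LinearIsometryEquiv.norm_map]; exact hDχ x
  have hηg : ∀ (t : ℝ) (x : (EuclideanSpace ℝ (Fin 3))), ‖η t • gradient χ x‖ ≤ C₁ / R := fun t x => by
    rw [norm_smul, Real.norm_eq_abs, abs_of_nonneg (hη0 t)]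
    calc η t * ‖gradient χ x‖ ≤ 1 * (C₁ / R) := mul_le_mul (hη1 t) (hgχ x) (norm_nonneg _) zero_le_one
      _ = C₁ / R := one_mul _
  have hC₁R : 0 ≤ C₁ / R := by positivity
  -- the dominating function with the box indicator
  set Ψ' : ℝ × (EuclideanSpace ℝ (Fin 3)) → ℝ := fun z => Ψ z + indicator Kc (fun _ => (1 : ℝ)) z with hΨ'
  have hΨ'i : IntegrableOn Ψ' strip volume := Integrable.add hΨi hind1
  have hΨ'1 : ∀ z ∈ Kc, Ψ z + 1 ≤ Ψ' z ∧ 1 ≤ Ψ' z := fun z hz => by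
    rw [hΨ']; dsimp only; rw [indicator_of_mem hz]; exact ⟨le_rfl, by linarith [hΨ0 z]⟩
  -- abbreviations for the slices
  have absw : ∀ z : ℝ × (EuclideanSpace ℝ (Fin 3)), ‖u z.1 z.2 - heatFlow u₀ (ν * z.1) z.2‖ ^ 3 ≤ Ψ z := fun z => by
    rw [hΨ]; dsimp only; nlinarith [pow_nonneg (norm_nonneg (u z.1 z.2)) 3,
      pow_nonneg (norm_nonneg (heatFlow u₀ (ν * z.1) z.2)) 3, Real.rpow_nonneg (norm_nonneg (p z.1 z.2)) (3 / 2 : ℝ)]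
  have absu : ∀ z : ℝ × (EuclideanSpace ℝ (Fin 3)), ‖u z.1 z.2‖ ^ 3 ≤ Ψ z := fun z => by
    rw [hΨ]; dsimp only; nlinarith [pow_nonneg (norm_nonneg (u z.1 z.2 - heatFlow u₀ (ν * z.1) z.2)) 3,
      pow_nonneg (norm_nonneg (heatFlow u₀ (ν * z.1) z.2)) 3, Real.rpow_nonneg (norm_nonneg (p z.1 z.2)) (3 / 2 : ℝ)]
  have abse : ∀ z : ℝ × (EuclideanSpace ℝ (Fin 3)), ‖heatFlow u₀ (ν * z.1) z.2‖ ^ 3 ≤ Ψ z := fun z => by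
    rw [hΨ]; dsimp only; nlinarith [pow_nonneg (norm_nonneg (u z.1 z.2 - heatFlow u₀ (ν * z.1) z.2)) 3,
      pow_nonneg (norm_nonneg (u z.1 z.2)) 3, Real.rpow_nonneg (norm_nonneg (p z.1 z.2)) (3 / 2 : ℝ)]
  have abs3 : ∀ z : ℝ × (EuclideanSpace ℝ (Fin 3)), ‖u z.1 z.2‖ ^ 3 + ‖u z.1 z.2 - heatFlow u₀ (ν * z.1) z.2‖ ^ 3 +
      ‖heatFlow u₀ (ν * z.1) z.2‖ ^ 3 ≤ Ψ z := fun z => by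
    rw [hΨ]; dsimp only; linarith [Real.rpow_nonneg (norm_nonneg (p z.1 z.2)) (3 / 2 : ℝ)]
  have absp : ∀ z : ℝ × (EuclideanSpace ℝ (Fin 3)), ‖p z.1 z.2‖ ^ (3 / 2 : ℝ) ≤ Ψ z := fun z => by
    rw [hΨ]; dsimp only; nlinarith [pow_nonneg (norm_nonneg (u z.1 z.2 - heatFlow u₀ (ν * z.1) z.2)) 3,
      pow_nonneg (norm_nonneg (u z.1 z.2)) 3, pow_nonneg (norm_nonneg (heatFlow u₀ (ν * z.1) z.2)) 3]
  -- ### (P1) `|w|² η' χ`: integrable, and `∫∫ = ∫ η' y`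
  have hP1 := integrable_and_abs_integral_le_of_strip_bound (S := S) (c := Cη')
    (F := fun z : ℝ × (EuclideanSpace ℝ (Fin 3)) => ‖u z.1 z.2 - heatFlow u₀ (ν * z.1) z.2‖ ^ 2 * (deriv η z.1 * χ z.2)) (Ψ := Ψ')
    ((hwm.norm.pow 2).mul (hη'm.mul hχm')) (fun z hz => by rw [(offstrip z hz).2, zero_mul, mul_zero]) hΨ'i
    (fun z _ => by
      by_cases hz : z ∈ Kc
      · obtain ⟨h1, -⟩ := hΨ'1 z hz
        have hw0 := norm_nonneg (u z.1 z.2 - heatFlow u₀ (ν * z.1) z.2)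
        have h2 : ‖u z.1 z.2 - heatFlow u₀ (ν * z.1) z.2‖ ^ 2 ≤ ‖u z.1 z.2 - heatFlow u₀ (ν * z.1) z.2‖ ^ 3 + 1 := by
          nlinarith [sq_nonneg (‖u z.1 z.2 - heatFlow u₀ (ν * z.1) z.2‖ - 1), sq_nonneg ‖u z.1 z.2 - heatFlow u₀ (ν * z.1) z.2‖]
        rw [abs_mul, abs_of_nonneg (sq_nonneg _), abs_mul]
        calc ‖u z.1 z.2 - heatFlow u₀ (ν * z.1) z.2‖ ^ 2 * (|deriv η z.1| * |χ z.2|)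
            ≤ (‖u z.1 z.2 - heatFlow u₀ (ν * z.1) z.2‖ ^ 3 + 1) * (Cη' * 1) :=
              mul_le_mul h2 (mul_le_mul ((Real.norm_eq_abs _).symm.le.trans (hCη' _)) (hχb _) (abs_nonneg _) hCη'0)
                (by positivity) (by positivity)
          _ ≤ Cη' * Ψ' z := by nlinarith [absw z, h1]
      · have hΨ'0 : 0 ≤ Cη' * Ψ' z := mul_nonneg hCη'0 (by rw [hΨ']; exact add_nonneg (hΨ0 z) (indicator_nonneg (fun _ _ => zero_le_one) _))
        rcases weightK z hz with ⟨-, h⟩ | ⟨h, -, -⟩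
        · rw [h]; simpa using hΨ'0
        · rw [h]; simpa using hΨ'0)
  have hΨ'nn : ∀ z, 0 ≤ Ψ' z := fun z => by
    rw [hΨ']; exact add_nonneg (hΨ0 z) (indicator_nonneg (fun _ _ => zero_le_one) _)
  have hw23 : ∀ z : ℝ × (EuclideanSpace ℝ (Fin 3)), ‖u z.1 z.2 - heatFlow u₀ (ν * z.1) z.2‖ ^ 2 ≤ ‖u z.1 z.2 - heatFlow u₀ (ν * z.1) z.2‖ ^ 3 + 1 := fun z => by
    nlinarith [sq_nonneg (‖u z.1 z.2 - heatFlow u₀ (ν * z.1) z.2‖ - 1), sq_nonneg ‖u z.1 z.2 - heatFlow u₀ (ν * z.1) z.2‖, norm_nonneg (u z.1 z.2 - heatFlow u₀ (ν * z.1) z.2)]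
  -- ### (P5) the coupling `ηχ ‖De‖ |w|²`
  have hP5 := integrable_and_abs_integral_le_of_strip_bound (S := S) (c := D₁)
    (F := fun z : ℝ × (EuclideanSpace ℝ (Fin 3)) => (η z.1 * χ z.2) * (‖fderiv ℝ (heatFlow u₀ (ν * z.1)) z.2‖ * ‖u z.1 z.2 - heatFlow u₀ (ν * z.1) z.2‖ ^ 2)) (Ψ := Ψ')
    ((hηm.mul hχm').mul (hDem.norm.mul (hwm.norm.pow 2))) (fun z hz => by rw [(offstrip z hz).1, zero_mul, zero_mul]) hΨ'i
    (fun z _ => by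
      by_cases hz : z ∈ Kc
      · obtain ⟨h1, -⟩ := hΨ'1 z hz
        have hD := hDe₁ z.1 hz.1.1 z.2
        rw [abs_mul, abs_mul, abs_of_nonneg (hη0 _), abs_of_nonneg (hχ0 _), abs_mul, abs_norm, abs_of_nonneg (sq_nonneg _)]
        calc η z.1 * χ z.2 * (‖fderiv ℝ (heatFlow u₀ (ν * z.1)) z.2‖ * ‖u z.1 z.2 - heatFlow u₀ (ν * z.1) z.2‖ ^ 2)
            ≤ 1 * 1 * (D₁ * (‖u z.1 z.2 - heatFlow u₀ (ν * z.1) z.2‖ ^ 3 + 1)) := by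
              refine mul_le_mul (mul_le_mul (hη1 _) (hχ1 _) (hχ0 _) zero_le_one)
                (mul_le_mul hD (hw23 z) (sq_nonneg _) hD₁0) (by positivity) (by positivity)
          _ ≤ D₁ * Ψ' z := by nlinarith [absw z, h1]
      · have h0 : 0 ≤ D₁ * Ψ' z := mul_nonneg hD₁0 (hΨ'nn z)
        rcases weightK z hz with ⟨h, -⟩ | ⟨h, -, -⟩
        · rw [h]; simpa using h0
        · rw [h]; simpa using h0)
  -- ### (P6) the quartic term `ηχ |e|⁴`
  have hP6 := integrable_and_abs_integral_le_of_strip_bound (S := S) (c := M ^ 4)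
    (F := fun z : ℝ × (EuclideanSpace ℝ (Fin 3)) => (η z.1 * χ z.2) * ‖heatFlow u₀ (ν * z.1) z.2‖ ^ 4) (Ψ := Ψ')
    ((hηm.mul hχm').mul (hem.norm.pow 4)) (fun z hz => by rw [(offstrip z hz).1, zero_mul, zero_mul]) hΨ'i
    (fun z _ => by
      by_cases hz : z ∈ Kc
      · obtain ⟨-, h1⟩ := hΨ'1 z hz
        rw [abs_mul, abs_mul, abs_of_nonneg (hη0 _), abs_of_nonneg (hχ0 _), abs_of_nonneg (by positivity)]
        calc η z.1 * χ z.2 * ‖heatFlow u₀ (ν * z.1) z.2‖ ^ 4 ≤ 1 * 1 * M ^ 4 :=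
              mul_le_mul (mul_le_mul (hη1 _) (hχ1 _) (hχ0 _) zero_le_one)
                (pow_le_pow_left₀ (norm_nonneg _) (heM _ _) 4) (by positivity) (by positivity)
          _ ≤ M ^ 4 * Ψ' z := by nlinarith [pow_nonneg hM0 4]
      · have h0 : 0 ≤ M ^ 4 * Ψ' z := mul_nonneg (by positivity) (hΨ'nn z)
        rcases weightK z hz with ⟨h, -⟩ | ⟨h, -, -⟩
        · rw [h]; simpa using h0
        · rw [h]; simpa using h0)
  -- ### (P2) the `Δχ_R` term: Young with the parameter `λ = R^{-1/3}`
  set lam : ℝ := R⁻¹ ^ ((3 : ℝ)⁻¹) with hlam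
  have hlam0 : 0 < lam := Real.rpow_pos_of_pos (inv_pos.2 hR) _
  have hlam3 : lam ^ 3 = R⁻¹ := by
    have h := Real.rpow_inv_natCast_pow (n := 3) (inv_nonneg.2 hR.le) (by norm_num)
    norm_num at h
    rw [hlam, show ((3 : ℝ)⁻¹) = 1 / 3 by norm_num]
    exact h
  set Ψ₂ : ℝ × (EuclideanSpace ℝ (Fin 3)) → ℝ := fun z => (2 / 3) * R⁻¹ * Ψ z + (1 / 3) * C₂ ^ 3 * R⁻¹ ^ 4 * indicator Kc (fun _ => (1 : ℝ)) z
    with hΨ₂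
  have hΨ₂i : IntegrableOn Ψ₂ strip volume := Integrable.add (Integrable.const_mul hΨi _) (Integrable.const_mul hind1 _)
  have hΨ₂nn : ∀ z, 0 ≤ Ψ₂ z := fun z => by
    rw [hΨ₂]; exact add_nonneg (by positivity) (mul_nonneg (by positivity) (indicator_nonneg (fun _ _ => zero_le_one) _))
  have hP2 := integrable_and_abs_integral_le_of_strip_bound (S := S) (c := 1)
    (F := fun z : ℝ × (EuclideanSpace ℝ (Fin 3)) => ‖u z.1 z.2 - heatFlow u₀ (ν * z.1) z.2‖ ^ 2 * (η z.1 * (Δ χ) z.2)) (Ψ := Ψ₂)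
    ((hwm.norm.pow 2).mul (hηm.mul hΔχm')) (fun z hz => by rw [(offstrip z hz).1, zero_mul, mul_zero]) hΨ₂i
    (fun z _ => by
      rw [one_mul]
      by_cases hz : z ∈ Kc
      · have hY := sq_mul_le_two_cube_add_cube (mul_nonneg hlam0.le (norm_nonneg (u z.1 z.2 - heatFlow u₀ (ν * z.1) z.2)))
          (by positivity : (0 : ℝ) ≤ C₂ * lam * R⁻¹)
        rw [abs_mul, abs_of_nonneg (sq_nonneg _), abs_mul, abs_of_nonneg (hη0 _)]
        have hind : indicator Kc (fun _ => (1 : ℝ)) z = 1 := indicator_of_mem hz _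
        calc ‖u z.1 z.2 - heatFlow u₀ (ν * z.1) z.2‖ ^ 2 * (η z.1 * |(Δ χ) z.2|) ≤ ‖u z.1 z.2 - heatFlow u₀ (ν * z.1) z.2‖ ^ 2 * (1 * (C₂ / R ^ 2)) :=
              mul_le_mul_of_nonneg_left (mul_le_mul (hη1 _) (hΔχ _) (abs_nonneg _) zero_le_one) (sq_nonneg _)
          _ = (lam * ‖u z.1 z.2 - heatFlow u₀ (ν * z.1) z.2‖) ^ 2 * (C₂ * lam * R⁻¹) := by
              rw [show (lam * ‖u z.1 z.2 - heatFlow u₀ (ν * z.1) z.2‖) ^ 2 * (C₂ * lam * R⁻¹) = C₂ * lam ^ 3 * ‖u z.1 z.2 - heatFlow u₀ (ν * z.1) z.2‖ ^ 2 * R⁻¹ by ring, hlam3]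
              field_simp
          _ ≤ (2 * (lam * ‖u z.1 z.2 - heatFlow u₀ (ν * z.1) z.2‖) ^ 3 + (C₂ * lam * R⁻¹) ^ 3) / 3 := hY
          _ = (2 / 3) * R⁻¹ * ‖u z.1 z.2 - heatFlow u₀ (ν * z.1) z.2‖ ^ 3 + (1 / 3) * C₂ ^ 3 * R⁻¹ ^ 4 := by
              rw [show (2 * (lam * ‖u z.1 z.2 - heatFlow u₀ (ν * z.1) z.2‖) ^ 3 + (C₂ * lam * R⁻¹) ^ 3) / 3 =
                (2 / 3) * lam ^ 3 * ‖u z.1 z.2 - heatFlow u₀ (ν * z.1) z.2‖ ^ 3 + (1 / 3) * C₂ ^ 3 * lam ^ 3 * R⁻¹ ^ 3 by ring, hlam3]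
              ring
          _ ≤ Ψ₂ z := by
              have hmono := mul_le_mul_of_nonneg_left (absw z) (inv_nonneg.2 hR.le)
              rw [hΨ₂]; dsimp only; rw [hind, mul_one]
              nlinarith [hmono]
      · rcases weightK z hz with ⟨h, -⟩ | ⟨-, -, h⟩
        · rw [h]; simpa using hΨ₂nn z
        · rw [h]; simpa using hΨ₂nn z)
  have hIΨ₂ : ∫ z in strip, Ψ₂ z ≤ A₀ / R := by
    have hind_int : ∫ z in strip, indicator Kc (fun _ => (1 : ℝ)) z = (volume Kc).toReal := by
      rw [integral_indicator hKcm, Measure.restrict_restrict hKcm, inter_eq_self_of_subset_left hKcstrip,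
        setIntegral_const, smul_eq_mul, mul_one]
      rfl
    have hvol : (volume Kc).toReal ≤ S * ((2 * R) ^ 3 * V₁) :=
      (ENNReal.toReal_mono ENNReal.ofReal_ne_top hKcvol).trans (by rw [ENNReal.toReal_ofReal (by positivity)])
    rw [hΨ₂, integral_add (Integrable.const_mul hΨi _) (Integrable.const_mul hind1 _), integral_const_mul,
      integral_const_mul, hind_int, hA₀, ← hIΨ]
    have h1 : (1 / 3) * C₂ ^ 3 * R⁻¹ ^ 4 * (volume Kc).toReal ≤ (8 / 3) * C₂ ^ 3 * S * V₁ * R⁻¹ := by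
      calc (1 / 3) * C₂ ^ 3 * R⁻¹ ^ 4 * (volume Kc).toReal ≤ (1 / 3) * C₂ ^ 3 * R⁻¹ ^ 4 * (S * ((2 * R) ^ 3 * V₁)) :=
            mul_le_mul_of_nonneg_left hvol (by positivity)
        _ = (8 / 3) * C₂ ^ 3 * S * V₁ * R⁻¹ := by field_simp; ring
    have h2 : (2 / 3 * IΨ + 8 / 3 * C₂ ^ 3 * S * V₁) / R = 2 / 3 * R⁻¹ * IΨ + (8 / 3) * C₂ ^ 3 * S * V₁ * R⁻¹ := by
      rw [div_eq_mul_inv]; ring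
    rw [h2]
    linarith [h1]
  -- ### the junk terms carrying `∇χ_R`
  have hP3 := integrable_and_abs_integral_le_of_strip_bound (S := S) (c := C₁ / R)
    (F := fun z : ℝ × (EuclideanSpace ℝ (Fin 3)) => (‖u z.1 z.2 - heatFlow u₀ (ν * z.1) z.2‖ ^ 2 - ‖heatFlow u₀ (ν * z.1) z.2‖ ^ 2) * ⟪u z.1 z.2, η z.1 • gradient χ z.2⟫) (Ψ := Ψ)
    (((hwm.norm.pow 2).sub (hem.norm.pow 2)).mul (hum.inner (hηm.smul hgχm')))
    (fun z hz => by rw [(offstrip z hz).1, zero_smul, inner_zero_right, mul_zero]) hΨi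
    (fun z _ => by
      rw [abs_mul]
      have hin : |⟪u z.1 z.2, η z.1 • gradient χ z.2⟫| ≤ ‖u z.1 z.2‖ * (C₁ / R) :=
        (abs_real_inner_le_norm _ _).trans (mul_le_mul_of_nonneg_left (hηg _ _) (norm_nonneg _))
      have hY1 := sq_mul_le_two_cube_add_cube (norm_nonneg (u z.1 z.2 - heatFlow u₀ (ν * z.1) z.2)) (norm_nonneg (u z.1 z.2))
      have hY2 := sq_mul_le_two_cube_add_cube (norm_nonneg (heatFlow u₀ (ν * z.1) z.2)) (norm_nonneg (u z.1 z.2))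
      calc |‖u z.1 z.2 - heatFlow u₀ (ν * z.1) z.2‖ ^ 2 - ‖heatFlow u₀ (ν * z.1) z.2‖ ^ 2| * |⟪u z.1 z.2, η z.1 • gradient χ z.2⟫|
          ≤ (‖u z.1 z.2 - heatFlow u₀ (ν * z.1) z.2‖ ^ 2 + ‖heatFlow u₀ (ν * z.1) z.2‖ ^ 2) * (‖u z.1 z.2‖ * (C₁ / R)) :=
            mul_le_mul ((abs_sub _ _).trans (by rw [abs_of_nonneg (sq_nonneg _), abs_of_nonneg (sq_nonneg _)])) hin
              (abs_nonneg _) (by positivity)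
        _ = (C₁ / R) * (‖u z.1 z.2 - heatFlow u₀ (ν * z.1) z.2‖ ^ 2 * ‖u z.1 z.2‖ + ‖heatFlow u₀ (ν * z.1) z.2‖ ^ 2 * ‖u z.1 z.2‖) := by ring
        _ ≤ (C₁ / R) * Ψ z := by
            refine mul_le_mul_of_nonneg_left ?_ hC₁R
            nlinarith [abs3 z, hY1, hY2, pow_nonneg (norm_nonneg (u z.1 z.2)) 3,
              pow_nonneg (norm_nonneg (heatFlow u₀ (ν * z.1) z.2)) 3, hΨ0 z,
              pow_nonneg (norm_nonneg (u z.1 z.2 - heatFlow u₀ (ν * z.1) z.2)) 3])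
  have hP4 := integrable_and_abs_integral_le_of_strip_bound (S := S) (c := C₁ / R)
    (F := fun z : ℝ × (EuclideanSpace ℝ (Fin 3)) => p z.1 z.2 * ⟪u z.1 z.2 - heatFlow u₀ (ν * z.1) z.2, η z.1 • gradient χ z.2⟫) (Ψ := Ψ)
    (hpm.mul (hwm.inner (hηm.smul hgχm')))
    (fun z hz => by rw [(offstrip z hz).1, zero_smul, inner_zero_right, mul_zero]) hΨi
    (fun z _ => by
      rw [abs_mul]
      have hin : |⟪u z.1 z.2 - heatFlow u₀ (ν * z.1) z.2, η z.1 • gradient χ z.2⟫| ≤ ‖u z.1 z.2 - heatFlow u₀ (ν * z.1) z.2‖ * (C₁ / R) :=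
        (abs_real_inner_le_norm _ _).trans (mul_le_mul_of_nonneg_left (hηg _ _) (norm_nonneg _))
      have hY := mul_le_two_rpow_threeHalves_add_cube (abs_nonneg (p z.1 z.2))
        (norm_nonneg (u z.1 z.2 - heatFlow u₀ (ν * z.1) z.2))
      rw [← Real.norm_eq_abs] at hY
      calc |p z.1 z.2| * |⟪u z.1 z.2 - heatFlow u₀ (ν * z.1) z.2, η z.1 • gradient χ z.2⟫|
          ≤ ‖p z.1 z.2‖ * (‖u z.1 z.2 - heatFlow u₀ (ν * z.1) z.2‖ * (C₁ / R)) := mul_le_mul (Real.norm_eq_abs _).symm.le hin (abs_nonneg _) (norm_nonneg _)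
        _ = (C₁ / R) * (‖p z.1 z.2‖ * ‖u z.1 z.2 - heatFlow u₀ (ν * z.1) z.2‖) := by ring
        _ ≤ (C₁ / R) * Ψ z := by
            refine mul_le_mul_of_nonneg_left ?_ hC₁R
            nlinarith [absw z, absp z, hΨ0 z, hY, abs3 z, pow_nonneg (norm_nonneg (u z.1 z.2)) 3,
              pow_nonneg (norm_nonneg (heatFlow u₀ (ν * z.1) z.2)) 3])
  have hP7 := integrable_and_abs_integral_le_of_strip_bound (S := S) (c := C₁ / R)
    (F := fun z : ℝ × (EuclideanSpace ℝ (Fin 3)) => ‖heatFlow u₀ (ν * z.1) z.2‖ ^ 2 * ⟪u z.1 z.2 - heatFlow u₀ (ν * z.1) z.2, η z.1 • gradient χ z.2⟫) (Ψ := Ψ)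
    ((hem.norm.pow 2).mul (hwm.inner (hηm.smul hgχm')))
    (fun z hz => by rw [(offstrip z hz).1, zero_smul, inner_zero_right, mul_zero]) hΨi
    (fun z _ => by
      rw [abs_mul, abs_of_nonneg (sq_nonneg _)]
      have hin : |⟪u z.1 z.2 - heatFlow u₀ (ν * z.1) z.2, η z.1 • gradient χ z.2⟫| ≤ ‖u z.1 z.2 - heatFlow u₀ (ν * z.1) z.2‖ * (C₁ / R) :=
        (abs_real_inner_le_norm _ _).trans (mul_le_mul_of_nonneg_left (hηg _ _) (norm_nonneg _))
      have hY := sq_mul_le_two_cube_add_cube (norm_nonneg (heatFlow u₀ (ν * z.1) z.2))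
        (norm_nonneg (u z.1 z.2 - heatFlow u₀ (ν * z.1) z.2))
      calc ‖heatFlow u₀ (ν * z.1) z.2‖ ^ 2 * |⟪u z.1 z.2 - heatFlow u₀ (ν * z.1) z.2, η z.1 • gradient χ z.2⟫|
          ≤ ‖heatFlow u₀ (ν * z.1) z.2‖ ^ 2 * (‖u z.1 z.2 - heatFlow u₀ (ν * z.1) z.2‖ * (C₁ / R)) := mul_le_mul_of_nonneg_left hin (sq_nonneg _)
        _ = (C₁ / R) * (‖heatFlow u₀ (ν * z.1) z.2‖ ^ 2 * ‖u z.1 z.2 - heatFlow u₀ (ν * z.1) z.2‖) := by ring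
        _ ≤ (C₁ / R) * Ψ z := by
            refine mul_le_mul_of_nonneg_left ?_ hC₁R
            nlinarith [abs3 z, hY, pow_nonneg (norm_nonneg (u z.1 z.2)) 3, hΨ0 z,
              pow_nonneg (norm_nonneg (u z.1 z.2 - heatFlow u₀ (ν * z.1) z.2)) 3])
  have hP8 := integrable_and_abs_integral_le_of_strip_bound (S := S) (c := C₁ / R)
    (F := fun z : ℝ × (EuclideanSpace ℝ (Fin 3)) => ⟪heatFlow u₀ (ν * z.1) z.2, η z.1 • gradient χ z.2⟫ *
      ⟪heatFlow u₀ (ν * z.1) z.2, u z.1 z.2 - heatFlow u₀ (ν * z.1) z.2⟫) (Ψ := Ψ)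
    ((hem.inner (hηm.smul hgχm')).mul (hem.inner hwm))
    (fun z hz => by rw [(offstrip z hz).1, zero_smul, inner_zero_right, zero_mul]) hΨi
    (fun z _ => by
      rw [abs_mul]
      have hin1 : |⟪heatFlow u₀ (ν * z.1) z.2, η z.1 • gradient χ z.2⟫| ≤ ‖heatFlow u₀ (ν * z.1) z.2‖ * (C₁ / R) :=
        (abs_real_inner_le_norm _ _).trans (mul_le_mul_of_nonneg_left (hηg _ _) (norm_nonneg _))
      have hin2 : |⟪heatFlow u₀ (ν * z.1) z.2, u z.1 z.2 - heatFlow u₀ (ν * z.1) z.2⟫| ≤ ‖heatFlow u₀ (ν * z.1) z.2‖ * ‖u z.1 z.2 - heatFlow u₀ (ν * z.1) z.2‖ :=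
        abs_real_inner_le_norm _ _
      have hY := sq_mul_le_two_cube_add_cube (norm_nonneg (heatFlow u₀ (ν * z.1) z.2))
        (norm_nonneg (u z.1 z.2 - heatFlow u₀ (ν * z.1) z.2))
      calc |⟪heatFlow u₀ (ν * z.1) z.2, η z.1 • gradient χ z.2⟫| *
            |⟪heatFlow u₀ (ν * z.1) z.2, u z.1 z.2 - heatFlow u₀ (ν * z.1) z.2⟫|
          ≤ (‖heatFlow u₀ (ν * z.1) z.2‖ * (C₁ / R)) * (‖heatFlow u₀ (ν * z.1) z.2‖ * ‖u z.1 z.2 - heatFlow u₀ (ν * z.1) z.2‖) := mul_le_mul hin1 hin2 (abs_nonneg _) (by positivity)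
        _ = (C₁ / R) * (‖heatFlow u₀ (ν * z.1) z.2‖ ^ 2 * ‖u z.1 z.2 - heatFlow u₀ (ν * z.1) z.2‖) := by ring
        _ ≤ (C₁ / R) * Ψ z := by
            refine mul_le_mul_of_nonneg_left ?_ hC₁R
            nlinarith [abs3 z, hY, pow_nonneg (norm_nonneg (u z.1 z.2)) 3, hΨ0 z,
              pow_nonneg (norm_nonneg (u z.1 z.2 - heatFlow u₀ (ν * z.1) z.2)) 3])
  have hP9 := integrable_and_abs_integral_le_of_strip_bound (S := S) (c := C₁ / R)
    (F := fun z : ℝ × (EuclideanSpace ℝ (Fin 3)) => ⟪heatFlow u₀ (ν * z.1) z.2, η z.1 • gradient χ z.2⟫ * ‖heatFlow u₀ (ν * z.1) z.2‖ ^ 2) (Ψ := Ψ)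
    ((hem.inner (hηm.smul hgχm')).mul (hem.norm.pow 2))
    (fun z hz => by rw [(offstrip z hz).1, zero_smul, inner_zero_right, zero_mul]) hΨi
    (fun z _ => by
      rw [abs_mul, abs_pow, abs_norm]
      have hin1 : |⟪heatFlow u₀ (ν * z.1) z.2, η z.1 • gradient χ z.2⟫| ≤ ‖heatFlow u₀ (ν * z.1) z.2‖ * (C₁ / R) :=
        (abs_real_inner_le_norm _ _).trans (mul_le_mul_of_nonneg_left (hηg _ _) (norm_nonneg _))
      calc |⟪heatFlow u₀ (ν * z.1) z.2, η z.1 • gradient χ z.2⟫| * ‖heatFlow u₀ (ν * z.1) z.2‖ ^ 2 ≤ (‖heatFlow u₀ (ν * z.1) z.2‖ * (C₁ / R)) * ‖heatFlow u₀ (ν * z.1) z.2‖ ^ 2 :=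
            mul_le_mul_of_nonneg_right hin1 (sq_nonneg _)
        _ = (C₁ / R) * ‖heatFlow u₀ (ν * z.1) z.2‖ ^ 3 := by ring
        _ ≤ (C₁ / R) * Ψ z := mul_le_mul_of_nonneg_left (abse z) hC₁R)
  -- ### (P1') `|w|² η χ`, for the integrability of `η y`
  have hP1b := integrable_and_abs_integral_le_of_strip_bound (S := S) (c := 1)
    (F := fun z : ℝ × (EuclideanSpace ℝ (Fin 3)) => ‖u z.1 z.2 - heatFlow u₀ (ν * z.1) z.2‖ ^ 2 * (η z.1 * χ z.2)) (Ψ := Ψ')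
    ((hwm.norm.pow 2).mul (hηm.mul hχm')) (fun z hz => by rw [(offstrip z hz).1, zero_mul, mul_zero]) hΨ'i
    (fun z _ => by
      rw [one_mul]
      by_cases hz : z ∈ Kc
      · obtain ⟨h1, -⟩ := hΨ'1 z hz
        rw [abs_mul, abs_of_nonneg (sq_nonneg _), abs_mul, abs_of_nonneg (hη0 _), abs_of_nonneg (hχ0 _)]
        calc ‖u z.1 z.2 - heatFlow u₀ (ν * z.1) z.2‖ ^ 2 * (η z.1 * χ z.2) ≤ (‖u z.1 z.2 - heatFlow u₀ (ν * z.1) z.2‖ ^ 3 + 1) * (1 * 1) :=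
              mul_le_mul (hw23 z) (mul_le_mul (hη1 _) (hχ1 _) (hχ0 _) zero_le_one) (mul_nonneg (hη0 _) (hχ0 _))
                (by positivity)
          _ ≤ Ψ' z := by nlinarith [absw z, h1]
      · rcases weightK z hz with ⟨h, -⟩ | ⟨h, -, -⟩
        · rw [h]; simpa using hΨ'nn z
        · rw [h]; simpa using hΨ'nn z)
  -- ### outer integrals
  have hI1 : Integrable (fun t => deriv η t * y t) := by
    refine hP1.1.integral_prod_left.congr (ae_of_all _ fun t => ?_)
    show ∫ x, ‖u t x - heatFlow u₀ (ν * t) x‖ ^ 2 * (deriv η t * χ x) = deriv η t * y t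
    rw [hy, ← integral_const_mul]
    exact integral_congr_ae (ae_of_all _ fun x => by ring)
  have hI2 : Integrable (fun t => η t * zL t) := by
    refine hP2.1.integral_prod_left.congr (ae_of_all _ fun t => ?_)
    show ∫ x, ‖u t x - heatFlow u₀ (ν * t) x‖ ^ 2 * (η t * (Δ χ) x) = η t * zL t
    rw [hzL, ← integral_const_mul]
    exact integral_congr_ae (ae_of_all _ fun x => by ring)
  have hI1b : Integrable (fun t => η t * y t) := by
    refine hP1b.1.integral_prod_left.congr (ae_of_all _ fun t => ?_)
    show ∫ x, ‖u t x - heatFlow u₀ (ν * t) x‖ ^ 2 * (η t * χ x) = η t * y t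
    rw [hy, ← integral_const_mul]
    exact integral_congr_ae (ae_of_all _ fun x => by ring)
  -- the left-hand side
  have hL : (∫ t, ∫ x, frobeniusNormSq (G t x - fderiv ℝ (heatFlow u₀ (ν * t)) x) * (η t * χ x)) =
      ∫ t, η t * ∫ x, frobeniusNormSq (G t x - fderiv ℝ (heatFlow u₀ (ν * t)) x) * χ x :=
    integral_congr_ae (ae_of_all _ fun t => by
      show (∫ x, frobeniusNormSq (G t x - fderiv ℝ (heatFlow u₀ (ν * t)) x) * (η t * χ x)) =
        η t * ∫ x, frobeniusNormSq (G t x - fderiv ℝ (heatFlow u₀ (ν * t)) x) * χ x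
      rw [← integral_const_mul]; exact integral_congr_ae (ae_of_all _ fun x => by ring))
  -- (T1)
  have hT1' : (∫ t, ∫ x, ‖u t x - heatFlow u₀ (ν * t) x‖ ^ 2 * (deriv η t * χ x + ν * (η t * (Δ χ) x))) =
      (∫ t, deriv η t * y t) + ν * ∫ t, η t * zL t := by
    rw [integral_congr_ae (ae_of_all _ hT1), integral_add hI1 (hI2.const_mul ν), integral_const_mul]
  have hT1b : |∫ t, η t * zL t| ≤ A₀ / R := by
    have h := hP2.2
    have e : (∫ t, ∫ x, (fun z : ℝ × (EuclideanSpace ℝ (Fin 3)) => ‖u z.1 z.2 - heatFlow u₀ (ν * z.1) z.2‖ ^ 2 * (η z.1 * (Δ χ) z.2)) (t, x)) = ∫ t, η t * zL t :=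
      integral_congr_ae (ae_of_all _ fun t => by
        show ∫ x, ‖u t x - heatFlow u₀ (ν * t) x‖ ^ 2 * (η t * (Δ χ) x) = η t * zL t
        rw [hzL, ← integral_const_mul]
        exact integral_congr_ae (ae_of_all _ fun x => by ring))
    rw [e, one_mul] at h
    exact h.trans hIΨ₂
  -- (T4)
  have hαD : ∀ t, t₁ ≤ t → 2 ^ ((3 : ℝ) / 2) * (ν * t) ^ (-(1 / 2 : ℝ)) * M ≤ D₁ := by
    intro t ht
    have hr : (ν * t) ^ (-(1 / 2 : ℝ)) ≤ (ν * t₁) ^ (-(1 / 2 : ℝ)) :=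
      Real.rpow_le_rpow_of_nonpos (mul_pos hν ht₁) (mul_le_mul_of_nonneg_left ht hν.le) (by norm_num)
    rw [hD₁]
    exact mul_le_mul_of_nonneg_right (mul_le_mul_of_nonneg_left hr (by positivity)) hM0
  have hy0 : ∀ t, 0 ≤ y t := fun t => by
    rw [hy]; exact integral_nonneg fun x => mul_nonneg (sq_nonneg _) (hχ0 x)
  have hI4 : Integrable (fun t => η t * ((2 ^ ((3 : ℝ) / 2) * (ν * t) ^ (-(1 / 2 : ℝ)) * M) * y t)) := by
    have hmeas : AEStronglyMeasurable
        (fun t => (2 ^ ((3 : ℝ) / 2) * (ν * t) ^ (-(1 / 2 : ℝ)) * M) * (η t * y t)) volume := by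
      refine (Measurable.aestronglyMeasurable ?_).mul hI1b.aestronglyMeasurable
      exact (measurable_const.mul ((measurable_const.mul measurable_id).pow_const _)).mul measurable_const
    have h : Integrable (fun t => (2 ^ ((3 : ℝ) / 2) * (ν * t) ^ (-(1 / 2 : ℝ)) * M) * (η t * y t)) := by
      refine Integrable.mono' (hI1b.norm.const_mul D₁) hmeas (ae_of_all _ fun t => ?_)
      by_cases ht : t ∈ Icc t₁ t₂
      · rw [norm_mul, Real.norm_eq_abs, abs_of_nonneg (mul_nonneg (mul_nonneg (by positivity)
          (Real.rpow_nonneg (mul_nonneg hν.le (ht₁.le.trans ht.1)) _)) hM0)]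
        exact mul_le_mul_of_nonneg_right (hαD t ht.1) (norm_nonneg _)
      · rw [(hη_out t ht).1]; simp
    exact h.congr (ae_of_all _ fun t => by ring)
  have hT4' : (∫ t, ∫ x, (η t * χ x) * (‖fderiv ℝ (heatFlow u₀ (ν * t)) x‖ * ‖u t x - heatFlow u₀ (ν * t) x‖ ^ 2)) ≤
      ∫ t, η t * ((2 ^ ((3 : ℝ) / 2) * (ν * t) ^ (-(1 / 2 : ℝ)) * M) * y t) :=
    integral_mono hP5.1.integral_prod_left hI4 hT4
  have hα2 : (∫ t, η t * ((2 * (2 ^ ((3 : ℝ) / 2) * (ν * t) ^ (-(1 / 2 : ℝ)) * M)) * y t)) =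
      2 * ∫ t, η t * ((2 ^ ((3 : ℝ) / 2) * (ν * t) ^ (-(1 / 2 : ℝ)) * M) * y t) := by
    rw [← integral_const_mul]
    exact integral_congr_ae (ae_of_all _ fun t => by ring)
  -- (T5)
  have hI5 : Integrable (fun t => η t * (M * N3)) :=
    (hη.continuous.mul continuous_const).integrable_of_hasCompactSupport hηc.mul_right
  have hT5' : (∫ t, ∫ x, (η t * χ x) * ‖heatFlow u₀ (ν * t) x‖ ^ 4) ≤ ∫ t, η t * (M * N3) :=
    integral_mono hP6.1.integral_prod_left hI5 hT5
  have hT5'' : 1 / ν * (∫ t, ∫ x, (η t * χ x) * ‖heatFlow u₀ (ν * t) x‖ ^ 4) ≤ ∫ t, η t * (M * N3 / ν) := by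
    have e : (∫ t, η t * (M * N3 / ν)) = 1 / ν * ∫ t, η t * (M * N3) := by
      rw [show (fun t => η t * (M * N3 / ν)) = fun t => 1 / ν * (η t * (M * N3)) from funext fun t => by ring,
        integral_const_mul]
    rw [e]
    exact mul_le_mul_of_nonneg_left hT5' (by positivity)
  -- junk terms
  have hJ2 : |∫ t, ∫ x, (‖u t x - heatFlow u₀ (ν * t) x‖ ^ 2 - ‖heatFlow u₀ (ν * t) x‖ ^ 2) *
      ⟪u t x, η t • gradient χ x⟫| ≤ C₁ / R * IΨ := hP3.2
  have hJ3 : |∫ t, ∫ x, p t x * ⟪u t x - heatFlow u₀ (ν * t) x, η t • gradient χ x⟫| ≤ C₁ / R * IΨ := hP4.2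
  have hJ6 : |∫ t, ∫ x, ‖heatFlow u₀ (ν * t) x‖ ^ 2 * ⟪u t x - heatFlow u₀ (ν * t) x, η t • gradient χ x⟫| ≤
      C₁ / R * IΨ := hP7.2
  have hJ7 : |∫ t, ∫ x, ⟪heatFlow u₀ (ν * t) x, η t • gradient χ x⟫ *
      ⟪heatFlow u₀ (ν * t) x, u t x - heatFlow u₀ (ν * t) x⟫| ≤ C₁ / R * IΨ := hP8.2
  have hJ8 : |∫ t, ∫ x, ⟪heatFlow u₀ (ν * t) x, η t • gradient χ x⟫ * ‖heatFlow u₀ (ν * t) x‖ ^ 2| ≤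
      C₁ / R * IΨ := hP9.2
  -- ### conclusion
  have hErr : (8 * C₁ * IΨ + ν * A₀) / R = 8 * (C₁ / R * IΨ) + ν * (A₀ / R) := by
    field_simp
  rw [hL] at h5e
  rw [hT1'] at h5e
  rw [hErr, hα2]
  obtain ⟨hJ2a, hJ2b⟩ := abs_le.1 hJ2
  obtain ⟨hJ3a, hJ3b⟩ := abs_le.1 hJ3
  obtain ⟨hJ6a, hJ6b⟩ := abs_le.1 hJ6
  obtain ⟨hJ7a, hJ7b⟩ := abs_le.1 hJ7
  obtain ⟨hJ8a, hJ8b⟩ := abs_le.1 hJ8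
  obtain ⟨hT1ba, hT1bb⟩ := abs_le.1 hT1b
  have hpos : 0 ≤ C₁ / R * IΨ := by positivity
  nlinarith [mul_le_mul_of_nonneg_left hT1bb hν.le, hT4', hT5'', h5e]

end Main

end Literature.Analysis.FluidPDE
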